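import Literature.MathematicalPhysics.QuantumFieldTheory.Balaban1983to89.B7Ineq200General

/-!
# `Balaban1983to89.B7Ineq199General` — T. Bałaban, *Averaging operations for lattice gauge theories*, Commun. Math.
Phys. **98** (1985) 17–51 [Balaban1985Averaging], Sect. F, **Proposition 9, inequality (199) p. 49 IN PRINT'S SHAPE AT A
GENERAL (curved) BACKGROUND**: `|ṽ′⁻¹(c₋)R̄_{0,c}ṽ′(c₊) − 1| < Lα′₄ + C′₄L²(α₀α₄ + α′₃α′₄ + α′₄²)` with a constant
`C′₄ = C′₄(d)` INDEPENDENT OF `L` — kernel form over the concrete `ℤ^d`/Banach-algebra model of the `B7Prop1Explicit` lineage.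

statement-level skeleton of published theorems with citation tags; proofs where landed; nothing here is a claim about the Yang–Mills mass gap

PDF held: `paper:balaban1985-cmp98-averaging` (journal page = PDF page + 16); renders `…/1985-cmp98-averaging-p030`–`p033-x2.png`
(pp. 46–49) read as images by the unit.

CITATION HEADER (lean-in-tree rule).  Cell `lit-balaban` (HOME `run/shared/lean/pub/lit-balaban/`), unit `lit-balaban-r04`
(owner of block B7, gen 5), an ANNOUNCED build (HOME/STATUS.md `TAKING … (199) … → B7Ineq199General.lean`, 2026-08-21) — a
KERNEL PIECE for SKELETON row `B7.Prop9` (decl of record `B7.Prop9Printed`, abstract; flat kernel `B7Prop9Flat.prop9_flat`;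
@gen kernel `B7Prop9General.prop9_general`), rows touched: B7.Prop9 ((199) as printed @gen), B7.Eq181/B7.Eq199 ((181)–(197)).
Nothing of the abstract carrier `B7.lean` is instantiated; no new definition, no new named fact.

PRINT (pp. 46–49, verbatim where legible).  p. 46: (180) "`|v′ − 1| < α₄, |v′⁻¹(b₋)R_{0,b}v′(b₊) − 1| < α′₄, |v₁ − 1| < α₃,
|v₁⁻¹(y)(R₀v₁)(x) − 1| < Lα′₃`"; (181) "`(\overline{R₀v′v₁})(y) = v′(y)v₁(y)·exp[i Σ_{x∈B(y)} L^{−d}(1/i) log(v′v₁)⁻¹(y)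
(R_{0,y}v′v₁)(x)]`"; (182) "`(v′v₁)⁻¹(y)(R_{0,y}v′v₁)(x) = R(v₁⁻¹(y))[v′⁻¹(y)(R_{0,y}v′)(x)]·v₁⁻¹(y)(R_{0,y}v₁)(x)`, and
`|v′⁻¹(y)(R_{0,y}v′)(x) − 1| < |Γ_{y,x}|α′₄e^{|Γ_{y,x}|α′₄} = O(Lα′₄)`"; (184) "`ṽ′(y) = v′(y)exp[i Σ_{x∈B(y)} L^{−d}(1/i) log
v′⁻¹(y)(R_{0,y}v′)(x) + O(L²(α′₃ + α′₄)α′₄)]`"; (186) "`v′⁻¹(y)(R_{0,y}v′)(x) = Π_{b⊂Γ_{y,x}} R(V₀(Γ_{y,b₋}))V′_b = (R_{0,y}V′)(Γ_{y,x})`".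
p. 47: "`V̄_{0,c} = exp[i Σ_{x∈B(c₋)} L^{−d}(1/i) log V₀(Γ_{c,x} ∪ (−c))]V₀(c) = e^{iO(L²α₀)}V₀(c)`, hence `R̄_{0,c}v′(c₊) = R(V₀(c))v′(c₊) +
O(L²α₀|v′(c₊) − 1|) = R(V₀(c))v′(c₊) + O(L²α₀α₄)`" and (189).  p. 48: (190) "`−A_b = R_{0,b}A_{−b}`", (191), (192), "Let us now
estimate the terms `(R_{0,c₋}A)(Γ_{c,x} ∪ (−c))`. They almost vanish because by the definition (185) `A` is almost equal to the
derivative of `λ = (1/i) log v′`." (193)–(194) "`(R_{0,c₋}V′)(Γ_{c,x} ∪ (−c)) = v′⁻¹(c₋)R(V₀(Γ_{c,x} ∪ (−c)))v′(c₋) = 1 +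
v′⁻¹(c₋)[R(V₀(Γ_{c,x} ∪ (−c))) − 1](v′(c₋) − 1) = 1 + O(L²α₀α₄)`", (195), (196) "`ṽ′⁻¹(c₋)R̄_{0,c}ṽ′(c₊) − 1 = i Σ_{x∈B(c)}
L^{−d}(R_{0,c₋}A)([x, x′]) + O(L²(α₀α₄ + α₀α′₄ + α′₃α′₄ + α′₄²))`", (197).  p. 49: "**Proposition 9.** There exist positive constants
`C′₄, C′₅, c′₆` such that for arbitrary functions `V₀, v′, v₁` satisfying (180) with `α₀, α₃, α′₃, α₄, α′₄ ≦ c′₆`, the following bounds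
hold: `|ṽ′⁻¹(c₋)R̄_{0,c}ṽ′(c₊) − 1| < Lα′₄ + C′₄L²(α₀α₄ + α′₃α′₄ + α′₄²)`, (199) `|ṽ′(y) − 1| < α₄ + C′₅Lα′₄`. (200)  In these bounds we
have assumed that `α′₄ = O(α₄)`".

WHAT THIS FILE PROVES (kernel, no `sorry`, standard axioms; every constant explicit).  Setting as in `B7Prop9General`/
`B7Ineq200General`: `𝔸` a complete normed `ℂ`-algebra with `‖1‖ = 1`; `V₀ : ℤ^d → (Fin d → 𝔸ˣ)` with values in `U1` and (52)
`‖V₀(∂p) − 1‖ ≤ α₀`; site functions `v′, v₁`; `ṽ′ = B7Prop9General.vtilG L V₀ v′ v₁` ((178)/(179) one step, base point `y = Lz`);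
`V̄₀(c) = B7Prop1Explicit.bavg L V₀ (Lz) μ = e^{X_c}V₀(c)` ((42)/(43)).
* **`eq199_printed`** — (199) VERBATIM IN SHAPE: `‖ṽ′(c₋)⁻¹R(V̄₀(c))ṽ′(c₊) − 1‖ ≤ Lα′₄ + C′₄L²(α₀α₄ + α′₃α′₄ + α′₄²)` with
  `C′₄ = 2400(d+1)(d+4)`, under (180) `SiteBd v′ α₄` (`α₄ ≤ 1/20`), `CovBondBd V₀ v′ α′₄` (`100dLα′₄ ≤ 1`), `SiteBd v₁ α₃`
  (`α₃ ≤ 1/50`), `CovBlockBd L V₀ v₁ (Lα′₃)` (`50Lα′₃ ≤ 1`) and Prop. 2's `512(d+1)(d+4)L²α₀ ≤ 1` (print's `c′₆`, here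
  `c′₆(d, L)`).  NO extra power of `L` on the `α₀`-term (cf. `B7Prop9General.eq199_general`: `16(d+1)²L³α₀α₄ + …`), NO `α₀α′₄`
  term, and NO use of the proviso "`α′₄ = O(α₄)`".
* `eq199_printed_terms` — the same with itemised constants `Lα′₄ + 370d²L²α′₄² + 139·16(d+1)(d+4)L²α₀α₄ + 150dL²α′₃α′₄`.
* **`prop9_printed`** — Proposition 9 packaged as `B7Prop9General.prop9_general` is (the input of the induction of Prop. 10):
  `CovBondBd` of `z ↦ ṽ′(Lz)` at `rescale L (bavg L V₀)` with the constant of `eq199_printed`, and `SiteBd` with the `α₀`-free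
  constant `α₄ + 6dLα′₄` of `B7Ineq200General.eq200_printed` ((200) as printed).
* the steps, each a theorem: `norm_vtilG_sub_R0avg_le` ((181)–(184): `‖ṽ′(y) − \overline{R₀v′}(y)‖ ≤ 15(a² + aβ)`, `a = 2dLα′₄`,
  `β = Lα′₃`); `norm_coarse_R0avg_sub_one_le` ((186)–(197) for `\overline{R₀v′}` with the straight transporter:
  `≤ Lα′₄ + 70d²(Lα′₄)² + 13·16(d+1)(d+4)L²α₀α₄`); `loop_identity` + `Wcx_boxVec_eq` ((190)–(195): the closed loops
  `Γ_{c,x} ∪ (−c)` are the loops `B7Prop1Explicit.Wcx` of (42)); `norm_covLine_sub_one_le` ((196)–(197): the straight line,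
  `≤ Lα′₄ + (Lα′₄)²`); `norm_cov_sub_one_crude` ((194): `O(α₄)` for any transporter); `norm_R0avg_crude`,
  `norm_Sexp_R0fun_le_crude`; the generic second-order calculus `norm_exp_add_sub_exp_sub_le` (Duhamel:
  `‖e^{W+D} − e^{W} − D‖ ≤ (e^{‖W‖+‖W+D‖} − 1)‖D‖`), `norm_exp_wsum_mlog_sub_le`,
  `norm_quot_means_sub_le` (the (183)/(184) quotient of means, error `3χ² + 12χβ` with NO `β²`).
THE PROOF (print's (181)–(197), done multiplicatively — no logarithm of a product is expanded, so no BCH is needed).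
(a) (181)–(184): `ṽ′(y) = (v′v₁)(y)e^{S_P}e^{−S_B}v₁(y)⁻¹` with `P_x = R(v₁(y)⁻¹)[A_x]·B_x` ((182), `B7Eq208Analytic.prod_cov_split`),
`A_x = v′(y)⁻¹(R_{0,y}v′)(x)` (`‖A_x − 1‖ ≤ a`, `B7Prop10InLambda.covBlock_of_covBondBd`), `B_x = v₁(y)⁻¹(R_{0,y}v₁)(x)` (`≤ β`);
`e^{S_P}e^{−S_B} = (e^{S_P} − e^{S_B})e^{−S_B} + 1`, `S_P − S_B = Σ L^{−d}[log P_x − log B_x] = Σ L^{−d}R(v₁(y)⁻¹)(A_x − 1) + O(a(a+β))`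
(mean-value defect of `log`, `FederbushMean.norm_mlog_sub_mlog_sub_le`) and `e^{S_B + D} − e^{S_B} = D + O(‖D‖(‖S_B‖ + ‖D‖))`
(Duhamel, `Literature.Analysis.Calculus.exp_sub_exp_eq_integral`), whence `ṽ′(y) = \overline{R₀v′}(y) + O(a² + aβ)`, the
conjugation by `v₁(y)` being exact.  (b) p. 47: `V̄₀(c) = e^{X_c}V₀(c)`, `‖X_c‖ ≤ 32(d+1)(d+4)L²α₀`
(`B7Prop2Explicit.norm_Wcx_sub_one_le`, the non-abelian Stokes estimate of pp. 24–25), and `R(e^{X_c})` moves `R(V₀(c))\overline{R₀v′}(c₊)`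
by `≤ 6‖X_c‖·‖\overline{R₀v′}(c₊) − 1‖` (`B7Prop9General.norm_Rc_expUnit_sub_self_le`) where — this is the point — the CRUDE size
`‖\overline{R₀v′}(c₊) − 1‖ ≤ 7α₄` is used (print: "`O(L²α₀|v′(c₊) − 1|) = O(L²α₀α₄)`"), not the `O(α₄ + Lα′₄)` of (200).
(c) (186)–(197) for `\overline{R₀v′}`: to second order `\overline{R₀v′}(y) = v′(y)(1 + Σ_x L^{−d}(A_x − 1) + O(a²))`
((187)/(189)), so the quantity is `1 + Σ_x L^{−d}[(M − 1) − (A_x − 1) + R(V₀(c))(A′_{x′} − 1)] + O(a·Lα′₄ + a²)`,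
`M = v′(y)⁻¹R(V₀(c))v′(y′)`, `x′ = x + Le_μ`; the exact `loop_identity` `A_x·R(V₀(Γ_{y,x}))D_x = [v′(y)⁻¹R(W_x)v′(y)]·R(W_x)[M·R(V₀(c))A′_{x′}]`
(`D_x` the straight line `[x, x′]`, `W_x = V₀(Γ_{y,x})V₀([x,x′])V₀(Γ_{y′,x′})⁻¹V₀(c)⁻¹ = B7Prop1Explicit.Wcx`, `‖W_x − 1‖ ≤
16(d+1)(d+4)L²α₀`) gives `(M − 1) − (A_x − 1) + R(V₀(c))(A′_{x′} − 1) = R(V₀(Γ_{y,x}))(D_x − 1) + O(a·Lα′₄ + L²α₀·α₄)` — the loop is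
paid as `L²α₀` times the crude `O(α₄)` ((194)) — and `‖D_x − 1‖ ≤ Lα′₄ + (Lα′₄)²` ((196)–(197), `covWalk_pos` along `L` bonds).
READINGS (recorded; none is an objection to print).  (a) `U1`-valued background, Banach `|·|` (lineage reading; print `G ⊂ U(N)`).
(b) CONSTANTS `C′₄ = 2400(d+1)(d+4)` (print: "there exist positive constants"; `d`-dependence as for `C₁` in Prop. 3) and
SMALLNESS `c′₆ = c′₆(d, L)` explicit as listed (as in `B7Prop9Flat`/`B7Prop9General`).  (c) LATTICE: all of `ℤ^d` for `Ω′`,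
blocks `B(Lz) = Lz + [0,L)^d`, tree contours `treeWord`, straight coarse contour `seg μ L`; `≤` for `<`.  (d) Print's (199)
omits the `α₀α′₄` of (197) by the proviso `α′₄ = O(α₄)`; here no `α₀α′₄`-term arises at all.  (e) As print, `|v₁ − 1| < α₃` enters
only through sizes (`α₃ ≤ 1/50`).
DECLARATIONS: theorems only (8 private helpers); imports `B7Ineq200General`; everything else REUSED BY NAME
(`B7Prop9General.vtilG/CovBondBd/CovBlockBd/norm_Rc_sub_self_le/norm_Rc_expUnit_sub_self_le`, `B7Prop10InLambda.covWalk_pos/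
covBlock_of_covBondBd`, `B7Eq208Analytic.prod_cov_split`, `B7Ineq200General.eq200_printed`, `B7Prop1Explicit.{hol, seg, treeWord,
boxVec, gammaWord, Wcx, Xavg, bavg, U1, expUnit, mlog_units_conj, norm_avg_le, sum_weights, norm_units_conj_sub_one_le,
norm_exp_sub_one_le_of_norm_le, hol_revWord'}`, `B7Prop2Explicit.norm_Wcx_sub_one_le/rescale`, `B7Eq99Concrete.{R0avg, R0fun, savg, Sexp}`,
`B7Eq92Concrete.{Rc, expUnit_conj}`, `B7Prop9Flat.SiteBd`, `B7Prop6Flat.norm_units_inv_sub_one_le`, `MatrixLog.{mlog,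
norm_mlog_le_two_mul}`, `FederbushMean.{norm_mlog_sub_mlog_sub_le, norm_mlog_sub_sub_one_le}`, `Literature.Analysis.Calculus.
{exp_sub_exp_eq_integral, norm_exp_smul_sub_one_le, norm_mul_mul_sub_le_of_sub_one}`).  Unit `lit-balaban-r04` (gen 5), 2026-08-21.

v1.1 (unit `lit-balaban-r04` gen 22, DOCSTRING-ONLY; every declaration byte-identical with v1.0 p254367): the locator of (197) corrected
from "p.49" to p. 48 in the header tag (own-stem locator audit of the `[cite: Balaban1985Averaging, …]` tags against a display→page map of
CMP 98 built from the held text layer `paper:balaban1985-cmp98-averaging` and verified on the ×2 renders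
`…/1985-cmp98-averaging-p0NN-x2.png`: (197) is the last display of p. 48 (render p032); p. 49 opens with «From representation (184) we
obtain also» and (198)).

[cite: Balaban1985Averaging, Proposition 9 (199) p.49, (180)–(186) p.46, (187)–(189) p.47, (190)–(197) p.48, (198)–(200) p.49,
(42)–(43) pp.23–24, pp.24–25, (56)–(57) p.27, (78) p.30, (41) p.23]
-/

noncomputable section

open scoped BigOperators
open NormedSpace Finset

namespace Literature.MathematicalPhysics.QuantumFieldTheory.Balaban1983to89.B7Ineq199General

open B7Prop1Explicit B7Prop2Explicit MatrixLog B7Eq92Concrete B7Eq99Concrete B7Eq84Concrete B7Prop9Flat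
  B7Prop9General B7Prop10InLambda B7Eq208Analytic B7Ineq200General
open B7Prop6Flat (norm_units_inv_sub_one_le)

-- `Site` alone would resolve to the torus sites of `Setup.lean`; re-export the `ℤ^d` sites of `B7Prop1Explicit`.
export B7Prop1Explicit (Site)

variable {d : ℕ}

variable {𝔸 : Type*} [NormedRing 𝔸] [NormOneClass 𝔸] [NormedAlgebra ℂ 𝔸] [CompleteSpace 𝔸]

/-! ## §1 Second-order calculus of `exp` and `log` near `1` — the `O(·)`-terms of (183), (184), (187), (189) -/

section Calculus

omit [NormedAlgebra ℂ 𝔸] [CompleteSpace 𝔸] in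
/-- `‖u‖ ≤ 1 + ‖u − 1‖`. [folklore] -/
private theorem norm_le_one_add' (u : 𝔸) : ‖u‖ ≤ 1 + ‖u - 1‖ := by
  calc ‖u‖ = ‖(u - 1) + 1‖ := by rw [sub_add_cancel]
    _ ≤ ‖u - 1‖ + ‖(1 : 𝔸)‖ := norm_add_le _ _
    _ = 1 + ‖u - 1‖ := by rw [norm_one]; ring

/-- `e^t − 1 ≤ t + t²` for `0 ≤ t ≤ 1` (Mathlib's `|e^t − 1 − t| ≤ t²`). [folklore] -/
private theorem real_exp_sub_one_le {t : ℝ} (h0 : 0 ≤ t) (h1 : t ≤ 1) : Real.exp t - 1 ≤ t + t ^ 2 := by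
  have h := Real.abs_exp_sub_one_sub_id_le (x := t) (by rwa [abs_of_nonneg h0])
  have h' := (abs_le.mp h).2
  linarith

omit [NormOneClass 𝔸] [CompleteSpace 𝔸] in
/-- weighted sums: `‖Σ cᵢ fᵢ‖ ≤ (Σ cᵢ)·K` when `0 ≤ cᵢ` and `‖fᵢ‖ ≤ K`. [folklore] -/
private theorem norm_wsum_le {ι : Type*} (s : Finset ι) (c : ι → ℝ) (hc0 : ∀ i ∈ s, 0 ≤ c i) (f : ι → 𝔸) {K : ℝ}
    (hf : ∀ i ∈ s, ‖f i‖ ≤ K) : ‖∑ i ∈ s, c i • f i‖ ≤ (∑ i ∈ s, c i) * K := by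
  calc ‖∑ i ∈ s, c i • f i‖ ≤ ∑ i ∈ s, ‖c i • f i‖ := norm_sum_le _ _
    _ ≤ ∑ i ∈ s, c i * K := Finset.sum_le_sum fun i hi => by
        rw [norm_smul, Real.norm_of_nonneg (hc0 i hi)]
        exact mul_le_mul_of_nonneg_left (hf i hi) (hc0 i hi)
    _ = (∑ i ∈ s, c i) * K := by rw [Finset.sum_mul]

omit [NormOneClass 𝔸] in
/-- **The second-order expansion of the exponential around an arbitrary point** (the content of print's (41)/(184)
`O(·)`-bookkeeping in multiplicative form): `‖e^{W+D} − e^{W} − D‖ ≤ (e^{‖W‖+‖W+D‖} − 1)·‖D‖`.  PROOF: Duhamel's formula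
`e^{W+D} − e^{W} = ∫₀¹ e^{(1−r)W} D e^{r(W+D)} dr` (tree `Literature.Analysis.Calculus.exp_sub_exp_eq_integral`) and
`‖aDb − D‖ ≤ ((1 + ‖a − 1‖)(1 + ‖b − 1‖) − 1)‖D‖` pointwise in `r`.  In particular the error has NO pure-`W` term: it vanishes
with `D`. [cite: Balaban1985Averaging, (41) p.23, (183)–(184) p.46] -/
theorem norm_exp_add_sub_exp_sub_le (W D : 𝔸) :
    ‖exp (W + D) - exp W - D‖ ≤ (Real.exp (‖W‖ + ‖W + D‖) - 1) * ‖D‖ := by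
  letI : NormedAlgebra ℚ 𝔸 := NormedAlgebra.restrictScalars ℚ ℝ 𝔸
  have hD := Literature.Analysis.Calculus.exp_sub_exp_eq_integral W (W + D)
  rw [add_sub_cancel_left] at hD
  have hcont : Continuous fun r : ℝ => exp ((1 - r) • W) * D * exp (r • (W + D)) := by fun_prop
  have hsub : exp (W + D) - exp W - D =
      ∫ r in (0 : ℝ)..1, (exp ((1 - r) • W) * D * exp (r • (W + D)) - D) := by
    rw [intervalIntegral.integral_sub (hcont.intervalIntegrable 0 1) intervalIntegrable_const, hD]
    simp
  rw [hsub]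
  have h := intervalIntegral.norm_integral_le_of_norm_le_const (a := (0 : ℝ)) (b := 1)
    (C := (Real.exp (‖W‖ + ‖W + D‖) - 1) * ‖D‖)
    (f := fun r : ℝ => exp ((1 - r) • W) * D * exp (r • (W + D)) - D) ?_
  · simpa using h
  · intro r hr
    rw [Set.uIoc_of_le zero_le_one] at hr
    have hr0 : 0 < r := hr.1
    have hr1 : r ≤ 1 := hr.2
    have ha : ‖exp ((1 - r) • W) - 1‖ ≤ Real.exp ‖W‖ - 1 :=
      Literature.Analysis.Calculus.norm_exp_smul_sub_one_le W (by rw [abs_of_nonneg (by linarith)]; linarith)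
    have hb : ‖exp (r • (W + D)) - 1‖ ≤ Real.exp ‖W + D‖ - 1 :=
      Literature.Analysis.Calculus.norm_exp_smul_sub_one_le (W + D) (by rw [abs_of_pos hr0]; exact hr1)
    have ha' : 1 + ‖exp ((1 - r) • W) - 1‖ ≤ Real.exp ‖W‖ := by linarith
    have hb' : 1 + ‖exp (r • (W + D)) - 1‖ ≤ Real.exp ‖W + D‖ := by linarith
    have hprod : (1 + ‖exp ((1 - r) • W) - 1‖) * (1 + ‖exp (r • (W + D)) - 1‖) ≤
        Real.exp ‖W‖ * Real.exp ‖W + D‖ :=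
      mul_le_mul ha' hb' (by positivity) (Real.exp_pos _).le
    calc ‖exp ((1 - r) • W) * D * exp (r • (W + D)) - D‖
        ≤ ((1 + ‖exp ((1 - r) • W) - 1‖) * (1 + ‖exp (r • (W + D)) - 1‖) - 1) * ‖D‖ :=
          Literature.Analysis.Calculus.norm_mul_mul_sub_le_of_sub_one _ _ _
      _ ≤ (Real.exp ‖W‖ * Real.exp ‖W + D‖ - 1) * ‖D‖ := by
          gcongr
      _ = (Real.exp (‖W‖ + ‖W + D‖) - 1) * ‖D‖ := by rw [Real.exp_add]

omit [NormOneClass 𝔸] in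
/-- `‖e^{D} − 1 − D‖ ≤ (e^{‖D‖} − 1)‖D‖` (`norm_exp_add_sub_exp_sub_le` at `W = 0`). [folklore] -/
private theorem norm_exp_sub_one_sub_le' (D : 𝔸) : ‖exp D - 1 - D‖ ≤ (Real.exp ‖D‖ - 1) * ‖D‖ := by
  have h := norm_exp_add_sub_exp_sub_le (0 : 𝔸) D
  simpa using h

omit [NormOneClass 𝔸] in
/-- **Second order of the mean (78) at the base point** (used for print's (187)/(189): the exponential of the average of
the logarithms is, to second order, one plus the average of the deviations): for a convex combination `cᵢ` and elements
`Zᵢ` with `‖Zᵢ − 1‖ ≤ ζ ≤ 1/10`,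
`‖exp(Σ cᵢ log Zᵢ) − 1 − Σ cᵢ(Zᵢ − 1)‖ ≤ 6ζ²` and `‖exp(−Σ cᵢ log Zᵢ) − 1 + Σ cᵢ(Zᵢ − 1)‖ ≤ 6ζ²`
(`log Z = (Z − 1) + O(|Z − 1|²)`, `FederbushMean.norm_mlog_sub_sub_one_le`; `e^{X} = 1 + X + O(|X|²)`).
[cite: Balaban1985Averaging, (187) p.47, (78) p.30, (21)–(23) p.21] -/
theorem norm_exp_wsum_mlog_sub_le {ι : Type*} [Fintype ι] (c : ι → ℝ) (hc0 : ∀ i, 0 ≤ c i) (hc1 : ∑ i, c i = 1)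
    (Z : ι → 𝔸) {ζ : ℝ} (hZ : ∀ i, ‖Z i - 1‖ ≤ ζ) (hζ : ζ ≤ 1 / 10) :
    ‖exp (∑ i, c i • mlog (Z i)) - 1 - ∑ i, c i • (Z i - 1)‖ ≤ 6 * ζ ^ 2 ∧
      ‖exp (-∑ i, c i • mlog (Z i)) - 1 + ∑ i, c i • (Z i - 1)‖ ≤ 6 * ζ ^ 2 := by
  classical
  have hζ0 : 0 ≤ ζ := by
    by_cases h : Nonempty ι
    · obtain ⟨i⟩ := h
      exact (norm_nonneg _).trans (hZ i)
    · rw [not_nonempty_iff] at h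
      have : ∑ i, c i = 0 := by simp
      rw [this] at hc1; exact absurd hc1 (by norm_num)
  set W : 𝔸 := ∑ i, c i • mlog (Z i) with hW
  set P : 𝔸 := ∑ i, c i • (Z i - 1) with hP
  -- the sizes
  have hWn : ‖W‖ ≤ 2 * ζ := by
    have h := norm_wsum_le Finset.univ c (fun i _ => hc0 i) (fun i => mlog (Z i)) (K := 2 * ζ)
      (fun i _ => (norm_mlog_le_two_mul ((hZ i).trans (by linarith))).trans (by linarith [hZ i]))
    rw [hc1, one_mul] at h; exact h
  have hWP : ‖W - P‖ ≤ 10 / 9 * ζ ^ 2 := by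
    have hid : W - P = ∑ i, c i • (mlog (Z i) - (Z i - 1)) := by
      simp only [hW, hP, smul_sub, Finset.sum_sub_distrib]
    rw [hid]
    have h := norm_wsum_le Finset.univ c (fun i _ => hc0 i) (fun i => mlog (Z i) - (Z i - 1)) (K := 10 / 9 * ζ ^ 2)
      (fun i _ => by
        have hlt : ‖Z i - 1‖ < 1 := (hZ i).trans_lt (by linarith)
        refine (FederbushMean.norm_mlog_sub_sub_one_le hlt).trans ?_
        have h1 : ‖Z i - 1‖ / (1 - ‖Z i - 1‖) ≤ 10 / 9 * ζ := by
          rw [div_le_iff₀ (by linarith)]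
          nlinarith [hZ i, norm_nonneg (Z i - 1)]
        calc ‖Z i - 1‖ / (1 - ‖Z i - 1‖) * ‖Z i - 1‖ ≤ 10 / 9 * ζ * ζ :=
              mul_le_mul h1 (hZ i) (norm_nonneg _) (by positivity)
          _ = 10 / 9 * ζ ^ 2 := by ring)
    rw [hc1, one_mul] at h; exact h
  -- `e^{±W} − 1 ∓ W`
  have hexp2 : Real.exp (2 * ζ) - 1 ≤ 12 / 5 * ζ := by
    have h := real_exp_sub_one_le (t := 2 * ζ) (by positivity) (by linarith)
    nlinarith
  have hE : ∀ X : 𝔸, ‖X‖ ≤ 2 * ζ → ‖exp X - 1 - X‖ ≤ 24 / 5 * ζ ^ 2 := fun X hX => by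
    have hX0 := norm_nonneg X
    calc ‖exp X - 1 - X‖ ≤ (Real.exp ‖X‖ - 1) * ‖X‖ := norm_exp_sub_one_sub_le' X
      _ ≤ (Real.exp (2 * ζ) - 1) * (2 * ζ) := by
          have h1 : Real.exp ‖X‖ - 1 ≤ Real.exp (2 * ζ) - 1 := by gcongr
          have h2 : 0 ≤ Real.exp ‖X‖ - 1 := by linarith [Real.add_one_le_exp ‖X‖]
          exact mul_le_mul h1 hX hX0 (h2.trans h1)
      _ ≤ 12 / 5 * ζ * (2 * ζ) := by gcongr
      _ = 24 / 5 * ζ ^ 2 := by ring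
  refine ⟨?_, ?_⟩
  · have hid : exp W - 1 - P = (exp W - 1 - W) + (W - P) := by abel
    rw [hid]
    calc _ ≤ ‖exp W - 1 - W‖ + ‖W - P‖ := norm_add_le _ _
      _ ≤ 24 / 5 * ζ ^ 2 + 10 / 9 * ζ ^ 2 := add_le_add (hE W hWn) hWP
      _ ≤ 6 * ζ ^ 2 := by nlinarith
  · have hid : exp (-W) - 1 + P = (exp (-W) - 1 - (-W)) - (W - P) := by abel
    rw [hid]
    calc _ ≤ ‖exp (-W) - 1 - (-W)‖ + ‖W - P‖ := norm_sub_le _ _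
      _ ≤ 24 / 5 * ζ ^ 2 + 10 / 9 * ζ ^ 2 := add_le_add (hE (-W) (by rwa [norm_neg])) hWP
      _ ≤ 6 * ζ ^ 2 := by nlinarith

end Calculus

/-! ## §2 The quotient of two means — (181)–(184): `ṽ′(y) = v′(y)·exp[Σ L^{−d} log v′(y)⁻¹(R_{0,y}v′)(x) + O(L²(α′₃+α′₄)α′₄)]` -/

section Quotient
set_option maxHeartbeats 400000 in
/-- **The quotient of the means of `XB` and of `B` is, to second order, the mean deviation of `X`** — the kernel of
(181)–(184): for a convex combination `cᵢ`, `‖Xᵢ − 1‖ ≤ χ ≤ 1/10`, `‖Bᵢ − 1‖ ≤ β ≤ 1/50`,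
`‖exp(Σcᵢ log XᵢBᵢ)·exp(−Σcᵢ log Bᵢ) − 1 − Σcᵢ(Xᵢ − 1)‖ ≤ 3χ² + 12χβ` — NO `β²`-term (at `X ≡ 1` the quotient is exactly `1`):
`log XB − log B = (X − 1)B + O((χ+β)·χ)` (`FederbushMean.norm_mlog_sub_mlog_sub_le`), then `norm_exp_add_sub_exp_sub_le` around
`W = Σcᵢ log Bᵢ`.  (Print: "(183) … + O(L²α′₃α′₄). A constant in the bound above is an absolute constant" and (184).)
[cite: Balaban1985Averaging, (181)–(184) p.46, (41) p.23] -/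
theorem norm_quot_means_sub_le {ι : Type*} [Fintype ι] (c : ι → ℝ) (hc0 : ∀ i, 0 ≤ c i) (hc1 : ∑ i, c i = 1)
    (X B : ι → 𝔸) {χ β : ℝ} (hX : ∀ i, ‖X i - 1‖ ≤ χ) (hB : ∀ i, ‖B i - 1‖ ≤ β) (hχ : χ ≤ 1 / 10) (hβ : β ≤ 1 / 50) :
    ‖exp (∑ i, c i • mlog (X i * B i)) * exp (-∑ i, c i • mlog (B i)) - 1 - ∑ i, c i • (X i - 1)‖
      ≤ 3 * χ ^ 2 + 12 * χ * β := by
  classical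
  by_cases hι : Nonempty ι
  swap
  · rw [not_nonempty_iff] at hι
    have : ∑ i, c i = 0 := by simp
    rw [this] at hc1; exact absurd hc1 (by norm_num)
  obtain ⟨i₀⟩ := hι
  have hχ0 : 0 ≤ χ := (norm_nonneg _).trans (hX i₀)
  have hβ0 : 0 ≤ β := (norm_nonneg _).trans (hB i₀)
  have hχβ0 : 0 ≤ χ * β := mul_nonneg hχ0 hβ0
  -- monomial bookkeeping (`χ ≤ 1/10`, `β ≤ 1/50`)
  have hm1 : χ ^ 2 * β ≤ χ * β / 10 := by
    have : χ ^ 2 * β = χ * (χ * β) := by ring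
    rw [this]; nlinarith
  have hm2 : χ * β ^ 2 ≤ χ * β / 50 := by
    have : χ * β ^ 2 = β * (χ * β) := by ring
    rw [this]; nlinarith
  have hm3 : χ ^ 2 * β ^ 2 ≤ χ * β / 500 := by
    have : χ ^ 2 * β ^ 2 = (χ * β) * (χ * β) := by ring
    have h5 : χ * β ≤ 1 / 500 := by nlinarith
    rw [this]; nlinarith
  have hm4 : χ ^ 2 ≤ χ / 10 := by nlinarith
  have hm5 : χ * β ≤ χ / 50 := by nlinarith
  set WP : 𝔸 := ∑ i, c i • mlog (X i * B i) with hWP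
  set WB : 𝔸 := ∑ i, c i • mlog (B i) with hWB
  set PX : 𝔸 := ∑ i, c i • (X i - 1) with hPX
  set D : 𝔸 := WP - WB with hD
  set p : ℝ := χ + β + χ * β with hp
  have hp1 : p ≤ 1 / 8 := by rw [hp]; linarith
  have hp0 : 0 ≤ p := by rw [hp]; positivity
  -- pointwise facts
  have hBn : ∀ i, ‖B i‖ ≤ 1 + β := fun i => (norm_le_one_add' (B i)).trans (by linarith [hB i])
  have hP1 : ∀ i, ‖X i * B i - 1‖ ≤ p := fun i => by
    have hid : X i * B i - 1 = (X i - 1) + (B i - 1) + (X i - 1) * (B i - 1) := by noncomm_ring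
    rw [hid, hp]
    calc _ ≤ ‖X i - 1‖ + ‖B i - 1‖ + ‖(X i - 1) * (B i - 1)‖ := norm_add₃_le
      _ ≤ χ + β + χ * β := by
          gcongr
          · exact hX i
          · exact hB i
          · exact (norm_mul_le _ _).trans (mul_le_mul (hX i) (hB i) (norm_nonneg _) hχ0)
  have hPB : ∀ i, ‖X i * B i - B i‖ ≤ χ * (1 + β) := fun i => by
    have hid : X i * B i - B i = (X i - 1) * B i := by noncomm_ring
    rw [hid]
    exact (norm_mul_le _ _).trans (mul_le_mul (hX i) (hBn i) (norm_nonneg _) hχ0)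
  have hPBX : ∀ i, ‖(X i * B i - B i) - (X i - 1)‖ ≤ χ * β := fun i => by
    have hid : (X i * B i - B i) - (X i - 1) = (X i - 1) * (B i - 1) := by noncomm_ring
    rw [hid]
    exact (norm_mul_le _ _).trans (mul_le_mul (hX i) (hB i) (norm_nonneg _) hχ0)
  -- `log XB − log B − (X − 1)`, pointwise: `≤ (8/7)p·χ(1+β) + χβ`
  have hplt : p < 1 := by linarith
  have he1 : ∀ i, ‖mlog (X i * B i) - mlog (B i) - (X i - 1)‖ ≤ 8 / 7 * p * (χ * (1 + β)) + χ * β := fun i => by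
    have h := FederbushMean.norm_mlog_sub_mlog_sub_le hplt (hP1 i) ((hB i).trans (by rw [hp]; linarith))
    have hdiv : p / (1 - p) ≤ 8 / 7 * p := by
      rw [div_le_iff₀ (by linarith)]
      nlinarith [mul_nonneg hp0 (by linarith : (0 : ℝ) ≤ 1 / 8 - p)]
    have hid : mlog (X i * B i) - mlog (B i) - (X i - 1) =
        (mlog (X i * B i) - mlog (B i) - (X i * B i - B i)) + ((X i * B i - B i) - (X i - 1)) := by abel
    rw [hid]
    calc _ ≤ ‖mlog (X i * B i) - mlog (B i) - (X i * B i - B i)‖ + ‖(X i * B i - B i) - (X i - 1)‖ :=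
          norm_add_le _ _
      _ ≤ p / (1 - p) * ‖X i * B i - B i‖ + χ * β := add_le_add h (hPBX i)
      _ ≤ 8 / 7 * p * (χ * (1 + β)) + χ * β := by
          gcongr
          · exact hPB i
  set e₁ : ℝ := 8 / 7 * p * (χ * (1 + β)) + χ * β with he₁
  have he₁0 : 0 ≤ e₁ := by rw [he₁]; positivity
  -- `‖D − PX‖ ≤ e₁`, `‖D‖ ≤ χ + e₁`, `‖WB‖ ≤ 2β`
  have hDPX : ‖D - PX‖ ≤ e₁ := by
    have hid : D - PX = ∑ i, c i • (mlog (X i * B i) - mlog (B i) - (X i - 1)) := by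
      simp only [hD, hWP, hWB, hPX, smul_sub, Finset.sum_sub_distrib]
    rw [hid]
    have h := norm_wsum_le Finset.univ c (fun i _ => hc0 i) _ (fun i _ => he1 i)
    rw [hc1, one_mul] at h; exact h
  have hPXn : ‖PX‖ ≤ χ := by
    have h := norm_wsum_le Finset.univ c (fun i _ => hc0 i) (fun i => X i - 1) (fun i _ => hX i)
    rw [hc1, one_mul] at h; exact h
  have hDn : ‖D‖ ≤ χ + e₁ := by
    have : D = (D - PX) + PX := by abel
    rw [this]; exact (norm_add_le _ _).trans (by linarith)
  have hWBn : ‖WB‖ ≤ 2 * β := by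
    have h := norm_wsum_le Finset.univ c (fun i _ => hc0 i) (fun i => mlog (B i)) (K := 2 * β)
      (fun i _ => (norm_mlog_le_two_mul ((hB i).trans (by linarith))).trans (by linarith [hB i]))
    rw [hc1, one_mul] at h; exact h
  -- the exponential around `WB`
  have hWPeq : WB + D = WP := by rw [hD]; abel
  have hR := norm_exp_add_sub_exp_sub_le WB D
  rw [hWPeq] at hR
  have hWPn : ‖WP‖ ≤ 2 * β + (χ + e₁) := by
    rw [← hWPeq]; exact (norm_add_le _ _).trans (add_le_add hWBn hDn)
  -- numerics: `e₁ ≤ 0.15χ`-ish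
  have he₁b : e₁ ≤ 6 / 5 * χ ^ 2 + 12 / 5 * χ * β := by
    have hx : e₁ = 8 / 7 * χ ^ 2 + 16 / 7 * (χ ^ 2 * β) + 8 / 7 * (χ * β) + 8 / 7 * (χ * β ^ 2) +
        8 / 7 * (χ ^ 2 * β ^ 2) + χ * β := by rw [he₁, hp]; ring
    rw [hx]; linarith [sq_nonneg χ]
  have he₁c : e₁ ≤ 1 / 5 * χ := by linarith
  set t : ℝ := ‖WB‖ + ‖WP‖ with ht
  have ht1 : t ≤ 4 * β + 6 / 5 * χ := by rw [ht]; linarith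
  have ht0 : 0 ≤ t := by rw [ht]; positivity
  have ht5 : t ≤ 1 / 5 := by linarith
  have hexpt : Real.exp t - 1 ≤ 6 / 5 * t := by
    have h := real_exp_sub_one_le ht0 (by linarith)
    have : t ^ 2 ≤ 1 / 5 * t := by rw [sq]; exact mul_le_mul_of_nonneg_right ht5 ht0
    linarith
  have hRb : ‖exp WP - exp WB - D‖ ≤ 6 / 5 * (4 * β + 6 / 5 * χ) * (6 / 5 * χ) := by
    refine hR.trans ?_
    have h1 : Real.exp t - 1 ≤ 6 / 5 * (4 * β + 6 / 5 * χ) := hexpt.trans (by linarith)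
    have h2 : ‖D‖ ≤ 6 / 5 * χ := by linarith
    have h3 : 0 ≤ Real.exp t - 1 := by linarith [Real.add_one_le_exp t]
    exact mul_le_mul h1 h2 (norm_nonneg _) (h3.trans h1)
  -- `f = e^{−WB} − 1`
  have hf : ‖exp (-WB) - 1‖ ≤ 11 / 5 * β := by
    have h := (norm_exp_sub_one_le_of_norm_le (show ‖-WB‖ ≤ 2 * β by rwa [norm_neg])).1
    have h2 := real_exp_sub_one_le (t := 2 * β) (by positivity) (by linarith)
    nlinarith
  -- assembly: `e^{WP}e^{−WB} − 1 − PX = (D − PX) + R + (D + R)·f`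
  have hinv : exp WB * exp (-WB) = (1 : 𝔸) := by
    have h := (expUnit WB).mul_inv
    rwa [val_inv_expUnit, val_expUnit, val_expUnit] at h
  have hid : exp WP * exp (-WB) - 1 - PX =
      (D - PX) + (exp WP - exp WB - D) + (D + (exp WP - exp WB - D)) * (exp (-WB) - 1) := by
    have : exp WP * exp (-WB) - 1 = (exp WP - exp WB) * exp (-WB) := by rw [sub_mul, hinv]
    rw [this]; noncomm_ring
  rw [hid]
  have hDR : ‖D + (exp WP - exp WB - D)‖ ≤ 6 / 5 * χ + 6 / 5 * (4 * β + 6 / 5 * χ) * (6 / 5 * χ) :=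
    (norm_add_le _ _).trans (add_le_add (by linarith) hRb)
  calc _ ≤ ‖D - PX‖ + ‖exp WP - exp WB - D‖ + ‖(D + (exp WP - exp WB - D)) * (exp (-WB) - 1)‖ := norm_add₃_le
    _ ≤ e₁ + 6 / 5 * (4 * β + 6 / 5 * χ) * (6 / 5 * χ) +
          (6 / 5 * χ + 6 / 5 * (4 * β + 6 / 5 * χ) * (6 / 5 * χ)) * (11 / 5 * β) := by
        gcongr
        exact (norm_mul_le _ _).trans (mul_le_mul hDR hf (norm_nonneg _) (by positivity))
    _ ≤ 3 * χ ^ 2 + 12 * χ * β := by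
        have hx : e₁ + 6 / 5 * (4 * β + 6 / 5 * χ) * (6 / 5 * χ) +
            (6 / 5 * χ + 6 / 5 * (4 * β + 6 / 5 * χ) * (6 / 5 * χ)) * (11 / 5 * β) =
            e₁ + 216 / 125 * χ ^ 2 + 144 / 25 * (χ * β) + 66 / 25 * (χ * β) +
              1584 / 125 * (χ * β ^ 2) + 2376 / 625 * (χ ^ 2 * β) := by ring
        rw [hx]; linarith [sq_nonneg χ]

end Quotient

/-! ## §3 (184) at a general background: `ṽ′(y)` is, to second order, the twisted average `\overline{R₀v′}(y)` of `v′` alone -/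

section Step0
set_option maxHeartbeats 400000 in
/-- **(181)–(184) p. 46, kernel form at a general `U1`-valued background.**  With `y = Lz`, `ṽ′(y) =
\overline{R₀v′v₁}(y)(\overline{R₀v₁}(y))⁻¹` (`B7Prop9General.vtilG`) and `\overline{R₀v′}(y) = v′(y)exp[Σ_{x∈B(y)}L^{−d}
log v′(y)⁻¹(R_{0,y}v′)(x)]` (`B7Eq99Concrete.R0avg`): `‖ṽ′(y) − \overline{R₀v′}(y)‖ ≤ 15(a² + aβ)`, `a = 2dLα′₄` (the size of
the block quantities `v′(y)⁻¹(R_{0,y}v′)(x) − 1`, print's `O(Lα′₄)` of (182)), `β` the (180d) constant of `v₁` (print `Lα′₃`) —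
print's (184) "`ṽ′(y) = v′(y)exp[i Σ L^{−d}(1/i) log v′⁻¹(y)(R_{0,y}v′)(x) + O(L²(α′₃ + α′₄)α′₄)]`".  PROOF: (182)
(`B7Eq208Analytic.prod_cov_split`) and `norm_quot_means_sub_le` with `Xᵣ = R(v₁(y)⁻¹)[v′(y)⁻¹(R_{0,y}v′)(x)]`, `Bᵣ =
v₁(y)⁻¹(R_{0,y}v₁)(x)`; the conjugation by `v₁(y)` of (181)/(184) is exact (`v₁(y)[R(v₁(y)⁻¹)X − 1]v₁(y)⁻¹ = X − 1`).
Hypotheses: `‖v′ − 1‖ ≤ α₄ ≤ 1/20`, (180b) `CovBondBd V₀ v′ α′₄` with `24dLα′₄ ≤ 1`, `‖v₁ − 1‖ ≤ α₃ ≤ 1/50`, (180d)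
`CovBlockBd L V₀ v₁ β`, `β ≤ 1/50`. [cite: Balaban1985Averaging, (181)–(184) p.46, (78) p.30, (178)–(179) p.45] -/
theorem norm_vtilG_sub_R0avg_le {L : ℕ} (hL : 1 ≤ L) {V₀ : Site d → Fin d → 𝔸ˣ} (hV : ∀ x κ, V₀ x κ ∈ U1 𝔸)
    {v' v₁ : Site d → 𝔸ˣ} {α₃ α₄ α₄' β : ℝ}
    (h4a : SiteBd v' α₄) (h4b : CovBondBd V₀ v' α₄') (h3c : SiteBd v₁ α₃) (h3d : CovBlockBd L V₀ v₁ β)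
    (hα₄ : α₄ ≤ 1 / 20) (hα₄' : 0 ≤ α₄') (hα₃ : α₃ ≤ 1 / 50) (hβ : β ≤ 1 / 50)
    (hs : 24 * ((d : ℝ) * L * α₄') ≤ 1) (z : Site d) :
    ‖((vtilG L V₀ v' v₁ ((L : ℤ) • z) : 𝔸ˣ) : 𝔸) - (R0avg L V₀ v' ((L : ℤ) • z) : 𝔸)‖
      ≤ 15 * ((2 * ((d : ℝ) * L * α₄')) ^ 2 + (2 * ((d : ℝ) * L * α₄')) * β) := by
  have hL0 : 0 < L := lt_of_lt_of_le zero_lt_one hL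
  set q : Site d := (L : ℤ) • z with hq
  set a : ℝ := 2 * ((d : ℝ) * L * α₄') with ha
  have hdL0 : 0 ≤ (d : ℝ) * L * α₄' := by positivity
  have ha0 : 0 ≤ a := by rw [ha]; positivity
  have ha1 : a ≤ 1 / 12 := by rw [ha]; linarith
  have hα₄0 : 0 ≤ α₄ := (norm_nonneg _).trans (h4a 0)
  have hα₃0 : 0 ≤ α₃ := (norm_nonneg _).trans (h3c 0)
  have hβ0 : 0 ≤ β := (norm_nonneg _).trans (h3d z fun _ => ⟨0, hL0⟩)
  have haβ0 : 0 ≤ a * β := mul_nonneg ha0 hβ0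
  -- the (181)/(182) families at the corner `q`
  set h₁ : (Fin d → Fin L) → 𝔸ˣ := fun r => hol V₀ q (treeWord (boxVec L r)) with hh₁
  set A : (Fin d → Fin L) → 𝔸ˣ := fun r => (v' q)⁻¹ * Rc (h₁ r) (v' (q + boxVec L r)) with hA
  set B : (Fin d → Fin L) → 𝔸ˣ := fun r => (v₁ q)⁻¹ * Rc (h₁ r) (v₁ (q + boxVec L r)) with hB
  set u : 𝔸ˣ := (v₁ q)⁻¹ with hu
  set X : (Fin d → Fin L) → 𝔸ˣ := fun r => Rc u (A r) with hX
  have hAr : ∀ r, ‖(A r : 𝔸) - 1‖ ≤ a := fun r =>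
    covBlock_of_covBondBd hV h4b hα₄' (by linarith) q r
  have hBr : ∀ r, ‖(B r : 𝔸) - 1‖ ≤ β := fun r => by
    have h := h3d z r
    rwa [R0fun_add] at h
  -- the conjugating unit `u = v₁(q)⁻¹`
  have hu1 : ‖(u : 𝔸) - 1‖ ≤ 2 * α₃ :=
    (norm_units_inv_sub_one_le (v₁ q) ((h3c q).trans (by linarith))).trans (by linarith [h3c q])
  have hun : ‖(u : 𝔸)‖ ≤ 1 + 2 * α₃ := (norm_le_one_add' _).trans (by linarith)
  have huin : ‖((u⁻¹ : 𝔸ˣ) : 𝔸)‖ ≤ 1 + α₃ := by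
    rw [hu, inv_inv]; exact (norm_le_one_add' _).trans (by linarith [h3c q])
  have hvn : ‖((v' q : 𝔸ˣ) : 𝔸)‖ ≤ 1 + α₄ := (norm_le_one_add' _).trans (by linarith [h4a q])
  have hXr : ∀ r, ‖(X r : 𝔸) - 1‖ ≤ 11 / 10 * a := fun r => by
    have hid : ((X r : 𝔸ˣ) : 𝔸) - 1 = (u : 𝔸) * ((A r : 𝔸) - 1) * ((u⁻¹ : 𝔸ˣ) : 𝔸) := by
      simp only [hX, Rc_apply, Units.val_mul]
      rw [mul_sub, sub_mul, mul_one, Units.mul_inv]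
    rw [hid]
    calc _ ≤ ‖(u : 𝔸)‖ * ‖(A r : 𝔸) - 1‖ * ‖((u⁻¹ : 𝔸ˣ) : 𝔸)‖ := norm_mul₃_le
      _ ≤ (1 + 2 * α₃) * a * (1 + α₃) := by gcongr; exact hAr r
      _ ≤ 11 / 10 * a := by nlinarith [mul_nonneg ha0 hα₃0, mul_nonneg (mul_nonneg ha0 hα₃0) hα₃0]
  -- the two second-order expansions
  have hE2 := norm_quot_means_sub_le (fun _ : Fin d → Fin L => ((L : ℝ) ^ d)⁻¹) (fun _ => by positivity)
    (sum_weights L hL) (fun r => (X r : 𝔸)) (fun r => (B r : 𝔸)) hXr hBr (by linarith) hβ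
  have hE1 := (norm_exp_wsum_mlog_sub_le (fun _ : Fin d → Fin L => ((L : ℝ) ^ d)⁻¹) (fun _ => by positivity)
    (sum_weights L hL) (fun r => (A r : 𝔸)) hAr (by linarith)).1
  set WP : 𝔸 := ∑ r, ((L : ℝ) ^ d)⁻¹ • mlog ((X r : 𝔸) * (B r : 𝔸)) with hWP
  set WB : 𝔸 := ∑ r, ((L : ℝ) ^ d)⁻¹ • mlog (B r : 𝔸) with hWB
  set WA : 𝔸 := ∑ r, ((L : ℝ) ^ d)⁻¹ • mlog (A r : 𝔸) with hWA
  set PX : 𝔸 := ∑ r, ((L : ℝ) ^ d)⁻¹ • ((X r : 𝔸) - 1) with hPX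
  set PA : 𝔸 := ∑ r, ((L : ℝ) ^ d)⁻¹ • ((A r : 𝔸) - 1) with hPA
  -- identification of the exponents (78) of the three averages
  have hSP : Sexp L (R0fun V₀ q (v' * v₁)) q = WP := by
    rw [Sexp_apply]
    refine Finset.sum_congr rfl fun r _ => ?_
    rw [R0fun_self, R0fun_add, Pi.mul_apply, Pi.mul_apply, prod_cov_split, Units.val_mul]
  have hSB : Sexp L (R0fun V₀ q v₁) q = WB := by
    rw [Sexp_apply]
    refine Finset.sum_congr rfl fun r _ => ?_
    rw [R0fun_self, R0fun_add]
  have hSA : Sexp L (R0fun V₀ q v') q = WA := by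
    rw [Sexp_apply]
    refine Finset.sum_congr rfl fun r _ => ?_
    rw [R0fun_self, R0fun_add]
  have huinv : ((u⁻¹ : 𝔸ˣ) : 𝔸) * (u : 𝔸) = 1 := Units.inv_mul u
  have hvt : ((vtilG L V₀ v' v₁ q : 𝔸ˣ) : 𝔸) =
      (v' q : 𝔸) * (((u⁻¹ : 𝔸ˣ) : 𝔸) * (exp WP * exp (-WB)) * (u : 𝔸)) := by
    rw [vtilG_apply, R0avg, R0avg, savg_apply, savg_apply, R0fun_self, R0fun_self, hSP, hSB, mul_inv_rev,
      val_inv_expUnit, Units.val_mul, Units.val_mul, Units.val_mul, val_expUnit, val_expUnit, Pi.mul_apply,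
      Units.val_mul, hu, inv_inv]
    simp only [mul_assoc]
  have hRA : ((R0avg L V₀ v' q : 𝔸ˣ) : 𝔸) = (v' q : 𝔸) * exp WA := by
    rw [R0avg, savg_apply, R0fun_self, hSA, Units.val_mul, val_expUnit]
  -- the exact conjugation `v₁(q)[R(v₁(q)⁻¹)X − 1]v₁(q)⁻¹ = X − 1`, summed
  have hconj : ((u⁻¹ : 𝔸ˣ) : 𝔸) * PX * (u : 𝔸) = PA := by
    simp only [hPX, hPA, Finset.mul_sum, Finset.sum_mul, mul_smul_comm, smul_mul_assoc]
    refine Finset.sum_congr rfl fun r _ => ?_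
    congr 1
    have hid : ((X r : 𝔸ˣ) : 𝔸) - 1 = (u : 𝔸) * ((A r : 𝔸) - 1) * ((u⁻¹ : 𝔸ˣ) : 𝔸) := by
      simp only [hX, Rc_apply, Units.val_mul]
      rw [mul_sub, sub_mul, mul_one, Units.mul_inv]
    rw [hid, ← mul_assoc, ← mul_assoc, huinv, one_mul, mul_assoc, Units.inv_mul, mul_one]
  set Q : 𝔸 := exp WP * exp (-WB) with hQ
  have hkey : ((u⁻¹ : 𝔸ˣ) : 𝔸) * Q * (u : 𝔸) - exp WA =
      ((u⁻¹ : 𝔸ˣ) : 𝔸) * (Q - 1 - PX) * (u : 𝔸) - (exp WA - 1 - PA) := by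
    have h1 : ((u⁻¹ : 𝔸ˣ) : 𝔸) * (Q - 1 - PX) * (u : 𝔸) = ((u⁻¹ : 𝔸ˣ) : 𝔸) * Q * (u : 𝔸) - 1 - PA := by
      rw [mul_sub, mul_sub, sub_mul, sub_mul, mul_one, huinv, hconj]
    rw [h1]; abel
  have hdiff : ((vtilG L V₀ v' v₁ q : 𝔸ˣ) : 𝔸) - (R0avg L V₀ v' q : 𝔸) =
      (v' q : 𝔸) * (((u⁻¹ : 𝔸ˣ) : 𝔸) * (Q - 1 - PX) * (u : 𝔸) - (exp WA - 1 - PA)) := by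
    rw [hvt, hRA, ← mul_sub, ← hkey]
  rw [hdiff]
  have hχ : (11 / 10 * a) ^ 2 = 121 / 100 * a ^ 2 := by ring
  calc _ ≤ ‖((v' q : 𝔸ˣ) : 𝔸)‖ * ‖((u⁻¹ : 𝔸ˣ) : 𝔸) * (Q - 1 - PX) * (u : 𝔸) - (exp WA - 1 - PA)‖ := norm_mul_le _ _
    _ ≤ (1 + α₄) * ((1 + α₃) * (3 * (11 / 10 * a) ^ 2 + 12 * (11 / 10 * a) * β) * (1 + 2 * α₃) + 6 * a ^ 2) := by
        gcongr
        calc _ ≤ ‖((u⁻¹ : 𝔸ˣ) : 𝔸) * (Q - 1 - PX) * (u : 𝔸)‖ + ‖exp WA - 1 - PA‖ := norm_sub_le _ _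
          _ ≤ ‖((u⁻¹ : 𝔸ˣ) : 𝔸)‖ * ‖Q - 1 - PX‖ * ‖(u : 𝔸)‖ + 6 * a ^ 2 := add_le_add norm_mul₃_le hE1
          _ ≤ (1 + α₃) * (3 * (11 / 10 * a) ^ 2 + 12 * (11 / 10 * a) * β) * (1 + 2 * α₃) + 6 * a ^ 2 := by
              gcongr
    _ ≤ 15 * (a ^ 2 + a * β) := by
        rw [hχ]
        have h1 : (1 + α₃) * (1 + 2 * α₃) ≤ 27 / 25 := by nlinarith
        have h2 : 0 ≤ 3 * (121 / 100 * a ^ 2) + 12 * (11 / 10 * a) * β := by positivity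
        have h3 : (1 + α₃) * (3 * (121 / 100 * a ^ 2) + 12 * (11 / 10 * a) * β) * (1 + 2 * α₃) ≤
            27 / 25 * (3 * (121 / 100 * a ^ 2) + 12 * (11 / 10 * a) * β) := by
          have := mul_le_mul_of_nonneg_left h1 h2
          nlinarith
        have h4 : 0 ≤ a ^ 2 := sq_nonneg a
        nlinarith [mul_nonneg hα₄0 h4, mul_nonneg hα₄0 haβ0]

end Step0

/-! ## §4 (185)–(196): straight contours, the closed-loop identity, and the coarse bond variable of `\overline{R₀v′}` -/

section Step2

omit [NormOneClass 𝔸] [NormedAlgebra ℂ 𝔸] [CompleteSpace 𝔸] in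
/-- the straight contour `seg μ L` consists of positive letters. [folklore] -/
private theorem seg_pos (μ : Fin d) (L : ℕ) : ∀ l ∈ seg μ (L : ℤ), l.2 = true := by
  intro l hl
  rw [seg_natCast, List.mem_replicate] at hl
  rw [hl.2]

/-- `(1 + α)ⁿ − 1 ≤ nα + (nα)²` for `0 ≤ α`, `nα ≤ 1`. [folklore] -/
private theorem one_add_pow_sub_one_le' {α : ℝ} (hα : 0 ≤ α) {n : ℕ} (hn : (n : ℝ) * α ≤ 1) :
    (1 + α) ^ n - 1 ≤ (n : ℝ) * α + ((n : ℝ) * α) ^ 2 := by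
  have h1 : (1 + α) ^ n ≤ Real.exp ((n : ℝ) * α) := by
    calc (1 + α) ^ n ≤ (Real.exp α) ^ n := by
          gcongr; linarith [Real.add_one_le_exp α]
      _ = Real.exp ((n : ℝ) * α) := by rw [← Real.exp_nat_mul]
  have h2 := real_exp_sub_one_le (t := (n : ℝ) * α) (by positivity) hn
  linarith

omit [NormedAlgebra ℂ 𝔸] [CompleteSpace 𝔸] in
/-- **The straight contour** (print's coarse bond `c = ⟨y, y + Le_μ⟩` and the lines `[x, x′]` of (191)/(196)): under
(180b) at a `U1`-valued background, `‖v(x)⁻¹R(V₀([x, x + Le_μ]))v(x + Le_μ) − 1‖ ≤ Lα′₄ + (Lα′₄)²` for `Lα′₄ ≤ 1` — `L`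
covariant bond factors (`B7Prop10InLambda.covWalk_pos`, print's (186)), `(1 + α′₄)^L − 1 ≤ Lα′₄ + (Lα′₄)²`; this is the
leading term `Lα′₄` of (197)/(199). [cite: Balaban1985Averaging, (186) p.46, (196)–(197) p.48] -/
theorem norm_covLine_sub_one_le {V₀ : Site d → Fin d → 𝔸ˣ} (hV : ∀ x κ, V₀ x κ ∈ U1 𝔸) {v : Site d → 𝔸ˣ} {a : ℝ}
    (hv : CovBondBd V₀ v a) (ha : 0 ≤ a) {L : ℕ} (hLa : (L : ℝ) * a ≤ 1) (x : Site d) (μ : Fin d) :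
    ‖((((v x)⁻¹ * Rc (hol V₀ x (seg μ L)) (v (x + (L : ℤ) • e μ)) : 𝔸ˣ)) : 𝔸) - 1‖
      ≤ (L : ℝ) * a + ((L : ℝ) * a) ^ 2 := by
  have h := covWalk_pos hV hv (seg μ (L : ℤ)) x (seg_pos μ L)
  rw [disp_seg, length_seg, Int.natAbs_natCast] at h
  exact h.trans (one_add_pow_sub_one_le' ha hLa)

omit [NormedAlgebra ℂ 𝔸] [CompleteSpace 𝔸] in
/-- **The crude size of a covariant quantity** (the device of (194): "`= 1 + v′⁻¹(c₋)[R(V₀(Γ)) − 1](v′(c₋) − 1) = 1 +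
O(L²α₀α₄)`" uses only `|v′ − 1| < α₄`): for ANY `h ∈ U1`, `‖v(y)⁻¹R(h)v(x) − 1‖ ≤ (11/5)α₄` when `‖v − 1‖ ≤ α₄ ≤ 1/20` —
independently of the length of the contour. [cite: Balaban1985Averaging, (194) p.48] -/
theorem norm_cov_sub_one_crude {h : 𝔸ˣ} (hh : h ∈ U1 𝔸) {v : Site d → 𝔸ˣ} {α₄ : ℝ} (hv : SiteBd v α₄)
    (hα₄ : α₄ ≤ 1 / 20) (y x : Site d) :
    ‖((((v y)⁻¹ * Rc h (v x) : 𝔸ˣ)) : 𝔸) - 1‖ ≤ 11 / 5 * α₄ := by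
  have hα0 : 0 ≤ α₄ := (norm_nonneg _).trans (hv y)
  have hR : ‖((Rc h (v x) : 𝔸ˣ) : 𝔸) - 1‖ ≤ α₄ := by
    rw [Rc_apply, Units.val_mul, Units.val_mul]; exact (norm_units_conj_sub_one_le hh _).trans (hv x)
  have hvi : ‖(((v y)⁻¹ : 𝔸ˣ) : 𝔸)‖ ≤ 1 + 2 * α₄ :=
    (norm_le_one_add' _).trans (by linarith [norm_units_inv_sub_one_le (v y) ((hv y).trans (by linarith)), hv y])
  have hid : ((((v y)⁻¹ * Rc h (v x) : 𝔸ˣ)) : 𝔸) - 1 =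
      (((v y)⁻¹ : 𝔸ˣ) : 𝔸) * ((((Rc h (v x) : 𝔸ˣ) : 𝔸) - 1) - (((v y : 𝔸ˣ) : 𝔸) - 1)) := by
    rw [Units.val_mul, mul_sub, mul_sub, mul_sub, mul_one, Units.inv_mul]; abel
  rw [hid]
  calc _ ≤ ‖(((v y)⁻¹ : 𝔸ˣ) : 𝔸)‖ * ‖((((Rc h (v x) : 𝔸ˣ) : 𝔸) - 1) - (((v y : 𝔸ˣ) : 𝔸) - 1))‖ :=
        norm_mul_le _ _
    _ ≤ (1 + 2 * α₄) * (α₄ + α₄) :=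
        mul_le_mul hvi ((norm_sub_le _ _).trans (add_le_add hR (hv y))) (norm_nonneg _) (by positivity)
    _ ≤ 11 / 5 * α₄ := by nlinarith

omit [NormOneClass 𝔸] [NormedAlgebra ℂ 𝔸] [CompleteSpace 𝔸] in
/-- **The loop of (42)/(193)–(195) as a product of transports**: `W_x := V₀(Γ_{c,x})V₀(c)⁻¹ = V₀(Γ_{y,x})·V₀([x, x′])·
V₀(Γ_{y′,x′})⁻¹·V₀(c)⁻¹` (`B7Prop1Explicit.Wcx`, the loop `Γ_{c,x} ∪ (−c)` of print; `x = y + r`, `x′ = x + Le_μ`, `y′ = y + Le_μ`).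
[cite: Balaban1985Averaging, (42) p.23, (14) p.19, (193)–(195) p.48] -/
theorem Wcx_boxVec_eq (L : ℕ) (V₀ : Site d → Fin d → 𝔸ˣ) (q : Site d) (μ : Fin d) (r : Fin d → Fin L) :
    Wcx L V₀ q μ (boxVec L r) = hol V₀ q (treeWord (boxVec L r)) * hol V₀ (q + boxVec L r) (seg μ L) *
      (hol V₀ (q + (L : ℤ) • e μ) (treeWord (boxVec L r)))⁻¹ * (hol V₀ q (seg μ L))⁻¹ := by
  rw [Wcx, gammaWord, hol_append, hol_append, disp_append, disp_treeWord, disp_seg,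
    hol_revWord' V₀ (x := q + (L : ℤ) • e μ) _ _ (by rw [disp_treeWord]; abel)]

omit [NormOneClass 𝔸] [NormedAlgebra ℂ 𝔸] [CompleteSpace 𝔸] in
/-- **THE CLOSED-LOOP IDENTITY behind (190)–(195)** (group algebra).  For a site function `v`, transports `h₁ = V₀(Γ_{y,x})`,
`h₂ = V₀([x,x′])`, `h₃ = V₀(Γ_{y′,x′})`, `S = V₀(c)` and the loop `W = h₁h₂h₃⁻¹S⁻¹`: the covariant quantity of `Γ_{y,x}`
times the transported one of `[x,x′]` equals the conjugated loop `v(y)⁻¹R(W)v(y)` (print's (194): "`= v′⁻¹(c₋)R(V₀(Γ_{c,x} ∪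
(−c)))v′(c₋)`") times the `R(W)`-rotation of [the covariant quantity of `c` times the `R(S)`-transported one of
`Γ_{y′,x′}`] — covariant quantities multiply along concatenated contours with transported second factors (print's (186)).
[cite: Balaban1985Averaging, (186) p.46, (190)–(195) p.48] -/
theorem loop_identity (vq vx vx' vq' h₁ h₂ h₃ S W : 𝔸ˣ) (hW : W = h₁ * h₂ * h₃⁻¹ * S⁻¹) :
    (vq⁻¹ * Rc h₁ vx) * Rc h₁ (vx⁻¹ * Rc h₂ vx') =
      (vq⁻¹ * Rc W vq) * Rc W ((vq⁻¹ * Rc S vq') * Rc S (vq'⁻¹ * Rc h₃ vx')) := by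
  subst hW
  simp only [Rc_apply, mul_inv_rev, inv_inv]
  group

/-- numerics of the loop error `ε = 13w₀α₄`. [folklore] -/
private theorem numerics_eps {α₄ w₀ n : ℝ} (hα0 : 0 ≤ α₄) (hα : α₄ ≤ 1 / 20) (hw : 0 ≤ w₀)
    (hn : n ≤ 11 / 5 * α₄ + 11 / 5 * α₄ + (11 / 5 * α₄) * (11 / 5 * α₄)) :
    (1 + 2 * α₄) * (2 * w₀ * α₄) * (1 + n) + 2 * w₀ * n ≤ 13 * w₀ * α₄ := by
  have hn' : n ≤ 93 / 20 * α₄ := by nlinarith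
  have h1 : (1 + 2 * α₄) * (1 + n) ≤ 3 / 2 := by nlinarith
  have h2 : (1 + 2 * α₄) * (2 * w₀ * α₄) * (1 + n) = (2 * w₀ * α₄) * ((1 + 2 * α₄) * (1 + n)) := by ring
  rw [h2]
  have hwα : 0 ≤ 2 * w₀ * α₄ := by positivity
  nlinarith [mul_le_mul_of_nonneg_left h1 hwα, mul_le_mul_of_nonneg_left hn' (by positivity : (0 : ℝ) ≤ 2 * w₀)]

/-- numerics of the second-order terms of `T₀`. [folklore] -/
private theorem numerics_T0 {ℓ dd a δ f : ℝ} (hd : 1 ≤ dd) (hℓ0 : 0 ≤ ℓ) (hℓ : 100 * (dd * ℓ) ≤ 1)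
    (ha : a = 2 * (dd * ℓ)) (hδ0 : 0 ≤ δ) (hδ : δ ≤ ℓ + ℓ ^ 2) (hf0 : 0 ≤ f) (hf : f ≤ a + 6 * a ^ 2) :
    δ + 2 * a * δ + 12 * a ^ 2 + 2 * f * δ + f ^ 2 + f ^ 2 * δ ≤ ℓ + 70 * dd ^ 2 * ℓ ^ 2 := by
  have hdℓ : dd * ℓ ≤ 1 / 100 := by linarith
  have hℓ1 : ℓ ≤ 1 / 100 := by nlinarith
  have ha0 : 0 ≤ a := by rw [ha]; positivity
  have ha1 : a ≤ 1 / 50 := by rw [ha]; linarith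
  have hf1 : f ≤ 28 / 25 * a := by nlinarith
  have hδ1 : δ ≤ 101 / 100 * ℓ := by nlinarith
  have hf2 : f ^ 2 ≤ (28 / 25 * a) ^ 2 := pow_le_pow_left₀ hf0 hf1 2
  -- everything in terms of `dd*ℓ` and `ℓ`
  have e1 : 2 * a * δ ≤ 2 * (2 * (dd * ℓ)) * (101 / 100 * ℓ) := by
    rw [ha]; exact mul_le_mul_of_nonneg_left hδ1 (by positivity)
  have e2 : 2 * f * δ ≤ 2 * (28 / 25 * (2 * (dd * ℓ))) * (101 / 100 * ℓ) := by
    have : 2 * f ≤ 2 * (28 / 25 * (2 * (dd * ℓ))) := by rw [← ha]; linarith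
    exact mul_le_mul this hδ1 hδ0 (by positivity)
  have e3 : f ^ 2 ≤ (28 / 25 * (2 * (dd * ℓ))) ^ 2 := by rwa [ha] at hf2
  have e4 : f ^ 2 * δ ≤ (28 / 25 * (2 * (dd * ℓ))) ^ 2 * (101 / 100 * ℓ) := mul_le_mul e3 hδ1 hδ0 (by positivity)
  have e5 : 12 * a ^ 2 = 48 * (dd * ℓ) ^ 2 := by rw [ha]; ring
  have hℓ2 : ℓ ^ 2 ≤ dd ^ 2 * ℓ ^ 2 := by nlinarith [sq_nonneg ℓ, mul_nonneg (by linarith : (0:ℝ) ≤ dd - 1) hℓ0]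
  have hdℓ2 : dd * ℓ * ℓ ≤ dd ^ 2 * ℓ ^ 2 := by
    have : dd * ℓ * ℓ ≤ dd * (dd * ℓ * ℓ) := le_mul_of_one_le_left (by positivity) hd
    nlinarith
  have hcube : (dd * ℓ) ^ 2 * ℓ ≤ (dd * ℓ) ^ 2 / 100 := by nlinarith [sq_nonneg (dd * ℓ)]
  nlinarith [sq_nonneg (dd * ℓ)]

set_option maxHeartbeats 400000 in
/-- **(186)–(196) AT A GENERAL BACKGROUND: the coarse covariant bond variable of the twisted averages of `v′` ALONE**
(`v₁ = 1`), rotated by the STRAIGHT transporter `V₀(c)`: with `y = Lz`, `y′ = L(z + e_μ)`, `c = ⟨y, y′⟩`,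
`‖(\overline{R₀v′}(y))⁻¹·R(V₀(c))·\overline{R₀v′}(y′) − 1‖ ≤ Lα′₄ + 70d²(Lα′₄)² + 13·16(d+1)(d+4)L²α₀·α₄`.
PROOF (print's, multiplicatively).  To second order `\overline{R₀v′}(y) = v′(y)(1 + Σ_x L^{−d}(A_x − 1) + O(a²))`,
`A_x = v′(y)⁻¹(R_{0,y}v′)(x)` (`norm_exp_wsum_mlog_sub_le`; print's (187)/(189)), so the quantity is `1 + Σ_x L^{−d}[(M − 1) −
(A_x − 1) + R(V₀(c))(A′_{x′} − 1)] + O(L²α′₄²)`, `M = v′(y)⁻¹R(V₀(c))v′(y′)` (print's (189)); by `loop_identity` and the bound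
`‖W_x − 1‖ ≤ 16(d+1)(d+4)L²α₀` on the loops `Γ_{c,x} ∪ (−c)` (`B7Prop2Explicit.norm_Wcx_sub_one_le`, the non-abelian Stokes
estimate of pp. 24–25) each bracket equals `R(V₀(Γ_{y,x}))(D_x − 1) + O(aLα′₄ + L²α₀·α₄)`, `D_x` the straight line `[x, x′]`
(print's (190)–(195): the closed loops "almost vanish", their cost being `L²α₀` times the CRUDE size `O(α₄)` of covariant
quantities — `norm_cov_sub_one_crude` — never `L²α₀·Lα′₄`), and `‖D_x − 1‖ ≤ Lα′₄ + (Lα′₄)²` (`norm_covLine_sub_one_le`;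
print's (196)–(197)).  Hypotheses: `V₀` in `U1` with (52) `‖V₀(∂p) − 1‖ ≤ α₀`, `512(d+1)(d+4)L²α₀ ≤ 1`; `‖v′ − 1‖ ≤ α₄ ≤ 1/20`;
(180b) `CovBondBd V₀ v′ α′₄` with `100dLα′₄ ≤ 1`. [cite: Balaban1985Averaging, (186)–(197) pp.46–49, (42) p.23, pp.24–25] -/
theorem norm_coarse_R0avg_sub_one_le {L : ℕ} (hL : 1 ≤ L) {V₀ : Site d → Fin d → 𝔸ˣ} (hV : ∀ x κ, V₀ x κ ∈ U1 𝔸)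
    {α₀ : ℝ} (hα₀ : 0 ≤ α₀)
    (h44 : ∀ (x : Site d) (κ μ : Fin d), κ ≠ μ → ‖((hol V₀ x (plaqWord κ μ) : 𝔸ˣ) : 𝔸) - 1‖ ≤ α₀)
    {v' : Site d → 𝔸ˣ} {α₄ α₄' : ℝ} (h4a : SiteBd v' α₄) (h4b : CovBondBd V₀ v' α₄')
    (hα₄ : α₄ ≤ 1 / 20) (hα₄' : 0 ≤ α₄') (hs : 100 * ((d : ℝ) * L * α₄') ≤ 1)
    (hα₀s : 512 * ((d : ℝ) + 1) * ((d : ℝ) + 4) * L ^ 2 * α₀ ≤ 1) (z : Site d) (μ : Fin d) :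
    ‖((((R0avg L V₀ v' ((L : ℤ) • z))⁻¹ *
        Rc (hol V₀ ((L : ℤ) • z) (seg μ L)) (R0avg L V₀ v' ((L : ℤ) • (z + e μ))) : 𝔸ˣ)) : 𝔸) - 1‖
      ≤ L * α₄' + 70 * (d : ℝ) ^ 2 * (L * α₄') ^ 2 + 13 * (16 * ((d : ℝ) + 1) * ((d : ℝ) + 4) * L ^ 2 * α₀) * α₄ := by
  have hL0 : 0 < L := lt_of_lt_of_le zero_lt_one hL
  have hd1 : (1 : ℝ) ≤ d := by exact_mod_cast Nat.succ_le_of_lt μ.pos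
  have hqq : (L : ℤ) • (z + e μ) = (L : ℤ) • z + (L : ℤ) • e μ := smul_add _ _ _
  rw [hqq]
  set q : Site d := (L : ℤ) • z with hq
  set q' : Site d := q + (L : ℤ) • e μ with hq'
  set S : 𝔸ˣ := hol V₀ q (seg μ L) with hSdef
  have hS : S ∈ U1 𝔸 := hol_mem hV _ _
  -- the small parameters
  set ℓ : ℝ := L * α₄' with hℓ
  set a : ℝ := 2 * ((d : ℝ) * L * α₄') with ha
  set δ : ℝ := ℓ + ℓ ^ 2 with hδ
  set w₀ : ℝ := 2 * (8 * ((d : ℝ) + 1) * ((d : ℝ) + 4) * (L : ℝ) ^ 2 * α₀) with hw₀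
  have hα₄0 : 0 ≤ α₄ := (norm_nonneg _).trans (h4a 0)
  have hℓ0 : 0 ≤ ℓ := by rw [hℓ]; positivity
  have hdℓ : 100 * ((d : ℝ) * ℓ) ≤ 1 := by
    calc 100 * ((d : ℝ) * ℓ) = 100 * ((d : ℝ) * L * α₄') := by rw [hℓ]; ring
      _ ≤ 1 := hs
  have hℓ1 : ℓ ≤ 1 / 100 := by nlinarith
  have hLa : (L : ℝ) * α₄' ≤ 1 := by rw [← hℓ]; linarith
  have ha0 : 0 ≤ a := by rw [ha]; positivity
  have haℓ : a = 2 * ((d : ℝ) * ℓ) := by rw [ha, hℓ, mul_assoc]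
  have ha1 : a ≤ 1 / 50 := by rw [haℓ]; linarith
  have hdLα : (d : ℝ) * L * α₄' ≤ 1 := by linarith
  have hδ0 : 0 ≤ δ := by rw [hδ]; positivity
  have hw0 : 0 ≤ w₀ := by rw [hw₀]; positivity
  -- the families
  set h₁ : (Fin d → Fin L) → 𝔸ˣ := fun r => hol V₀ q (treeWord (boxVec L r)) with hh₁
  set h₂ : (Fin d → Fin L) → 𝔸ˣ := fun r => hol V₀ (q + boxVec L r) (seg μ L) with hh₂
  set h₃ : (Fin d → Fin L) → 𝔸ˣ := fun r => hol V₀ q' (treeWord (boxVec L r)) with hh₃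
  set W : (Fin d → Fin L) → 𝔸ˣ := fun r => Wcx L V₀ q μ (boxVec L r) with hWdef
  set A : (Fin d → Fin L) → 𝔸ˣ := fun r => (v' q)⁻¹ * Rc (h₁ r) (v' (q + boxVec L r)) with hA
  set A' : (Fin d → Fin L) → 𝔸ˣ := fun r => (v' q')⁻¹ * Rc (h₃ r) (v' (q' + boxVec L r)) with hA'
  set D : (Fin d → Fin L) → 𝔸ˣ := fun r => (v' (q + boxVec L r))⁻¹ * Rc (h₂ r) (v' (q' + boxVec L r)) with hD
  set M₀ : 𝔸ˣ := (v' q)⁻¹ * Rc S (v' q') with hM₀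
  set N : (Fin d → Fin L) → 𝔸ˣ := fun r => M₀ * Rc S (A' r) with hN
  set C : (Fin d → Fin L) → 𝔸ˣ := fun r => (v' q)⁻¹ * Rc (W r) (v' q) with hC
  -- the loops
  have hWeq : ∀ r, W r = h₁ r * h₂ r * (h₃ r)⁻¹ * S⁻¹ := fun r => Wcx_boxVec_eq L V₀ q μ r
  have hWU : ∀ r, W r ∈ U1 𝔸 := fun r => by
    rw [hWeq]
    exact (U1 𝔸).mul_mem ((U1 𝔸).mul_mem ((U1 𝔸).mul_mem (hol_mem hV _ _) (hol_mem hV _ _))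
      ((U1 𝔸).inv_mem (hol_mem hV _ _))) ((U1 𝔸).inv_mem hS)
  have hW1 : ∀ r, ‖(W r : 𝔸) - 1‖ ≤ w₀ := fun r => B7Prop2Explicit.norm_Wcx_sub_one_le L hL V₀ hV hα₀ hα₀s h44 q μ r
  -- fine sizes
  have hAr : ∀ r, ‖(A r : 𝔸) - 1‖ ≤ a := fun r => covBlock_of_covBondBd hV h4b hα₄' hdLα q r
  have hA'r : ∀ r, ‖(A' r : 𝔸) - 1‖ ≤ a := fun r => covBlock_of_covBondBd hV h4b hα₄' hdLα q' r
  have hSA' : ∀ r, ‖((Rc S (A' r) : 𝔸ˣ) : 𝔸) - 1‖ ≤ a := fun r => by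
    rw [Rc_apply, Units.val_mul, Units.val_mul]; exact (norm_units_conj_sub_one_le hS _).trans (hA'r r)
  have hDr : ∀ r, ‖(D r : 𝔸) - 1‖ ≤ δ := fun r => by
    have hx : q' + boxVec L r = q + boxVec L r + (L : ℤ) • e μ := by rw [hq']; abel
    have h := norm_covLine_sub_one_le hV h4b hα₄' hLa (q + boxVec L r) μ
    rw [← hx] at h
    exact h
  have hRD : ∀ r, ‖((Rc (h₁ r) (D r) : 𝔸ˣ) : 𝔸) - 1‖ ≤ δ := fun r => by
    rw [Rc_apply, Units.val_mul, Units.val_mul]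
    exact (norm_units_conj_sub_one_le (hol_mem hV _ _) _).trans (hDr r)
  have hM : ‖(M₀ : 𝔸) - 1‖ ≤ δ := norm_covLine_sub_one_le hV h4b hα₄' hLa q μ
  -- crude sizes
  have hMc : ‖(M₀ : 𝔸) - 1‖ ≤ 11 / 5 * α₄ := norm_cov_sub_one_crude hS h4a hα₄ q q'
  have hA'c : ∀ r, ‖((Rc S (A' r) : 𝔸ˣ) : 𝔸) - 1‖ ≤ 11 / 5 * α₄ := fun r => by
    rw [Rc_apply, Units.val_mul, Units.val_mul]
    exact (norm_units_conj_sub_one_le hS _).trans (norm_cov_sub_one_crude (hol_mem hV _ _) h4a hα₄ q' _)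
  set n : ℝ := 11 / 5 * α₄ + 11 / 5 * α₄ + (11 / 5 * α₄) * (11 / 5 * α₄) with hn
  have hNc : ∀ r, ‖(N r : 𝔸) - 1‖ ≤ n := fun r => by
    have hid : ((N r : 𝔸ˣ) : 𝔸) - 1 = ((M₀ : 𝔸) - 1) + ((((Rc S (A' r) : 𝔸ˣ)) : 𝔸) - 1) +
        ((M₀ : 𝔸) - 1) * ((((Rc S (A' r) : 𝔸ˣ)) : 𝔸) - 1) := by
      simp only [hN, Units.val_mul]; noncomm_ring
    rw [hid, hn]
    calc _ ≤ ‖(M₀ : 𝔸) - 1‖ + ‖(((Rc S (A' r) : 𝔸ˣ)) : 𝔸) - 1‖ +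
          ‖((M₀ : 𝔸) - 1) * ((((Rc S (A' r) : 𝔸ˣ)) : 𝔸) - 1)‖ := norm_add₃_le
      _ ≤ _ := add_le_add (add_le_add hMc (hA'c r))
          ((norm_mul_le _ _).trans (mul_le_mul hMc (hA'c r) (norm_nonneg _) (by positivity)))
  have hn0 : 0 ≤ n := by rw [hn]; positivity
  have hvq : ‖(((v' q)⁻¹ : 𝔸ˣ) : 𝔸)‖ ≤ 1 + 2 * α₄ :=
    (norm_le_one_add' _).trans (by linarith [norm_units_inv_sub_one_le (v' q) ((h4a q).trans (by linarith)), h4a q])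
  have hCr : ∀ r, ‖(C r : 𝔸) - 1‖ ≤ (1 + 2 * α₄) * (2 * w₀ * α₄) := fun r => by
    have hid : ((C r : 𝔸ˣ) : 𝔸) - 1 = (((v' q)⁻¹ : 𝔸ˣ) : 𝔸) * ((((Rc (W r) (v' q) : 𝔸ˣ)) : 𝔸) - (v' q : 𝔸)) := by
      simp only [hC, Units.val_mul]; rw [mul_sub, Units.inv_mul]
    rw [hid]
    calc _ ≤ ‖(((v' q)⁻¹ : 𝔸ˣ) : 𝔸)‖ * ‖(((Rc (W r) (v' q) : 𝔸ˣ)) : 𝔸) - (v' q : 𝔸)‖ := norm_mul_le _ _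
      _ ≤ (1 + 2 * α₄) * (2 * w₀ * α₄) := by
          exact mul_le_mul hvq ((norm_Rc_sub_self_le (hWU r) (v' q)).trans
            (mul_le_mul (mul_le_mul_of_nonneg_left (hW1 r) (by norm_num)) (h4a q) (norm_nonneg _)
              (by positivity))) (norm_nonneg _) (by positivity)
  -- THE LOOP ERROR: `A·R(h₁)D − N = O(w₀α₄)`
  set ε : ℝ := 13 * w₀ * α₄ with hε
  have hII : ∀ r, A r * Rc (h₁ r) (D r) = C r * Rc (W r) (N r) := fun r =>
    loop_identity (v' q) (v' (q + boxVec L r)) (v' (q' + boxVec L r)) (v' q') (h₁ r) (h₂ r) (h₃ r) S (W r) (hWeq r)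
  have hεr : ∀ r, ‖((A r * Rc (h₁ r) (D r) : 𝔸ˣ) : 𝔸) - (N r : 𝔸)‖ ≤ ε := fun r => by
    rw [hII r, Units.val_mul]
    have hid : ((C r : 𝔸ˣ) : 𝔸) * ((Rc (W r) (N r) : 𝔸ˣ) : 𝔸) - (N r : 𝔸) =
        (((C r : 𝔸ˣ) : 𝔸) - 1) * ((Rc (W r) (N r) : 𝔸ˣ) : 𝔸) + ((((Rc (W r) (N r) : 𝔸ˣ) : 𝔸)) - (N r : 𝔸)) := by
      noncomm_ring
    rw [hid]
    have hRN : ‖((Rc (W r) (N r) : 𝔸ˣ) : 𝔸)‖ ≤ 1 + n := by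
      refine (norm_le_one_add' _).trans ?_
      rw [Rc_apply, Units.val_mul, Units.val_mul]
      linarith [(norm_units_conj_sub_one_le (hWU r) ((N r : 𝔸ˣ) : 𝔸)).trans (hNc r)]
    calc _ ≤ ‖(((C r : 𝔸ˣ) : 𝔸) - 1) * ((Rc (W r) (N r) : 𝔸ˣ) : 𝔸)‖ + ‖(((Rc (W r) (N r) : 𝔸ˣ) : 𝔸)) - (N r : 𝔸)‖ :=
          norm_add_le _ _
      _ ≤ (1 + 2 * α₄) * (2 * w₀ * α₄) * (1 + n) + 2 * w₀ * n := by
          exact add_le_add ((norm_mul_le _ _).trans (mul_le_mul (hCr r) hRN (norm_nonneg _) (by positivity)))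
            ((norm_Rc_sub_self_le (hWU r) (N r)).trans
              (mul_le_mul (mul_le_mul_of_nonneg_left (hW1 r) (by norm_num)) (hNc r) (norm_nonneg _)
                (by positivity)))
      _ ≤ ε := by rw [hε]; exact numerics_eps hα₄0 hα₄ hw0 le_rfl
  -- the first-order rearrangement: `(M − 1) − (A − 1) + (R(S)A′ − 1) = (R(h₁)D − 1) + O(aδ + ε)`
  have hJ : ∀ r, ‖((M₀ : 𝔸) - 1) - (((A r : 𝔸ˣ) : 𝔸) - 1) + ((((Rc S (A' r) : 𝔸ˣ)) : 𝔸) - 1) -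
      ((((Rc (h₁ r) (D r) : 𝔸ˣ)) : 𝔸) - 1)‖ ≤ 2 * a * δ + ε := fun r => by
    have hid : ((M₀ : 𝔸) - 1) - (((A r : 𝔸ˣ) : 𝔸) - 1) + ((((Rc S (A' r) : 𝔸ˣ)) : 𝔸) - 1) -
        ((((Rc (h₁ r) (D r) : 𝔸ˣ)) : 𝔸) - 1) =
        (((A r : 𝔸ˣ) : 𝔸) - 1) * ((((Rc (h₁ r) (D r) : 𝔸ˣ)) : 𝔸) - 1) -
          ((M₀ : 𝔸) - 1) * ((((Rc S (A' r) : 𝔸ˣ)) : 𝔸) - 1) -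
          (((A r * Rc (h₁ r) (D r) : 𝔸ˣ) : 𝔸) - (N r : 𝔸)) := by
      simp only [hN, Units.val_mul]; noncomm_ring
    rw [hid]
    calc _ ≤ ‖(((A r : 𝔸ˣ) : 𝔸) - 1) * ((((Rc (h₁ r) (D r) : 𝔸ˣ)) : 𝔸) - 1) -
          ((M₀ : 𝔸) - 1) * ((((Rc S (A' r) : 𝔸ˣ)) : 𝔸) - 1)‖ +
          ‖(((A r * Rc (h₁ r) (D r) : 𝔸ˣ) : 𝔸) - (N r : 𝔸))‖ := norm_sub_le _ _
      _ ≤ ‖(((A r : 𝔸ˣ) : 𝔸) - 1) * ((((Rc (h₁ r) (D r) : 𝔸ˣ)) : 𝔸) - 1)‖ +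
          ‖((M₀ : 𝔸) - 1) * ((((Rc S (A' r) : 𝔸ˣ)) : 𝔸) - 1)‖ +
          ‖(((A r * Rc (h₁ r) (D r) : 𝔸ˣ) : 𝔸) - (N r : 𝔸))‖ :=
          add_le_add (norm_sub_le _ _) le_rfl
      _ ≤ a * δ + δ * a + ε :=
          add_le_add (add_le_add ((norm_mul_le _ _).trans (mul_le_mul (hAr r) (hRD r) (norm_nonneg _) ha0))
            ((norm_mul_le _ _).trans (mul_le_mul hM (hSA' r) (norm_nonneg _) hδ0))) (hεr r)
      _ = 2 * a * δ + ε := by ring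
  -- the means `\overline{R₀v′}(q) = v′(q)e^{W_A}`, `R(S)\overline{R₀v′}(q′) = R(S)v′(q′)·e^{W_A″}` and their expansions
  set WA : 𝔸 := ∑ r : Fin d → Fin L, ((L : ℝ) ^ d)⁻¹ • mlog ((A r : 𝔸ˣ) : 𝔸) with hWA
  set WA' : 𝔸 := ∑ r : Fin d → Fin L, ((L : ℝ) ^ d)⁻¹ • mlog ((A' r : 𝔸ˣ) : 𝔸) with hWA'
  set WA'' : 𝔸 := ∑ r : Fin d → Fin L, ((L : ℝ) ^ d)⁻¹ • mlog (((Rc S (A' r) : 𝔸ˣ)) : 𝔸) with hWA''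
  set PA : 𝔸 := ∑ r : Fin d → Fin L, ((L : ℝ) ^ d)⁻¹ • (((A r : 𝔸ˣ) : 𝔸) - 1) with hPA
  set PA'' : 𝔸 := ∑ r : Fin d → Fin L, ((L : ℝ) ^ d)⁻¹ • ((((Rc S (A' r) : 𝔸ˣ)) : 𝔸) - 1) with hPA''
  have hc0 : (0 : ℝ) ≤ ((L : ℝ) ^ d)⁻¹ := by positivity
  have hE1m := (norm_exp_wsum_mlog_sub_le (fun _ : Fin d → Fin L => ((L : ℝ) ^ d)⁻¹) (fun _ => hc0)
    (sum_weights L hL) (fun r => ((A r : 𝔸ˣ) : 𝔸)) hAr (by linarith)).2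
  have hE1p := (norm_exp_wsum_mlog_sub_le (fun _ : Fin d → Fin L => ((L : ℝ) ^ d)⁻¹) (fun _ => hc0)
    (sum_weights L hL) (fun r => (((Rc S (A' r) : 𝔸ˣ)) : 𝔸)) hSA' (by linarith)).1
  have hSexpA : Sexp L (R0fun V₀ q v') q = WA := by
    rw [Sexp_apply]
    refine Finset.sum_congr rfl fun r _ => ?_
    rw [R0fun_self, R0fun_add]
  have hSexpA' : Sexp L (R0fun V₀ q' v') q' = WA' := by
    rw [Sexp_apply]
    refine Finset.sum_congr rfl fun r _ => ?_
    rw [R0fun_self, R0fun_add]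
  have hconjW : (S : 𝔸) * WA' * ((S⁻¹ : 𝔸ˣ) : 𝔸) = WA'' := by
    rw [hWA', hWA'', Finset.mul_sum, Finset.sum_mul]
    refine Finset.sum_congr rfl fun r _ => ?_
    rw [mul_smul_comm, smul_mul_assoc]
    congr 1
    show (S : 𝔸) * mlog ((A' r : 𝔸ˣ) : 𝔸) * ((S⁻¹ : 𝔸ˣ) : 𝔸) =
      mlog ((S : 𝔸) * ((A' r : 𝔸ˣ) : 𝔸) * ((S⁻¹ : 𝔸ˣ) : 𝔸))
    rw [mlog_units_conj hS ((hA'r r).trans_lt (by linarith))]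
  have hinvRA : ((((R0avg L V₀ v' q)⁻¹ : 𝔸ˣ)) : 𝔸) = exp (-WA) * (((v' q)⁻¹ : 𝔸ˣ) : 𝔸) := by
    rw [R0avg, savg_apply, R0fun_self, hSexpA, mul_inv_rev, Units.val_mul, val_inv_expUnit, val_expUnit]
  have hRcRA' : Rc S (R0avg L V₀ v' q') = Rc S (v' q') * expUnit WA'' := by
    rw [R0avg, savg_apply, R0fun_self, hSexpA', map_mul, ← hconjW, expUnit_conj]
  have hT0 : ((((R0avg L V₀ v' q)⁻¹ * Rc S (R0avg L V₀ v' q') : 𝔸ˣ)) : 𝔸) =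
      exp (-WA) * (M₀ : 𝔸) * exp WA'' := by
    rw [Units.val_mul, hinvRA, hRcRA', Units.val_mul, val_expUnit, hM₀, Units.val_mul]
    simp only [mul_assoc]
  -- sizes of the linear terms
  have hPAn : ‖PA‖ ≤ a := by
    have h := norm_wsum_le Finset.univ (fun _ : Fin d → Fin L => ((L : ℝ) ^ d)⁻¹) (fun _ _ => hc0)
      (fun r => ((A r : 𝔸ˣ) : 𝔸) - 1) (fun r _ => hAr r)
    rw [sum_weights L hL, one_mul] at h; exact h
  have hPA''n : ‖PA''‖ ≤ a := by
    have h := norm_wsum_le Finset.univ (fun _ : Fin d → Fin L => ((L : ℝ) ^ d)⁻¹) (fun _ _ => hc0)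
      (fun r => (((Rc S (A' r) : 𝔸ˣ)) : 𝔸) - 1) (fun r _ => hSA' r)
    rw [sum_weights L hL, one_mul] at h; exact h
  set f₁ : 𝔸 := exp (-WA) - 1 with hf₁
  set f₃ : 𝔸 := exp WA'' - 1 with hf₃
  set m₁ : 𝔸 := (M₀ : 𝔸) - 1 with hm₁
  set f : ℝ := a + 6 * a ^ 2 with hf
  have hf0 : 0 ≤ f := by rw [hf]; positivity
  have hf₁n : ‖f₁‖ ≤ f := by
    calc ‖f₁‖ = ‖(f₁ + PA) - PA‖ := by rw [add_sub_cancel_right]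
      _ ≤ ‖f₁ + PA‖ + ‖PA‖ := norm_sub_le _ _
      _ ≤ 6 * a ^ 2 + a := add_le_add hE1m hPAn
      _ = f := by rw [hf]; ring
  have hf₃n : ‖f₃‖ ≤ f := by
    calc ‖f₃‖ = ‖(f₃ - PA'') + PA''‖ := by rw [sub_add_cancel]
      _ ≤ ‖f₃ - PA''‖ + ‖PA''‖ := norm_add_le _ _
      _ ≤ 6 * a ^ 2 + a := add_le_add hE1p hPA''n
      _ = f := by rw [hf]; ring
  -- the algebra of `T₀ − 1`
  have hT0id : exp (-WA) * (M₀ : 𝔸) * exp WA'' - 1 =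
      (m₁ - PA + PA'') + ((f₁ + PA) + (f₃ - PA'') + (f₁ * m₁ + f₁ * f₃ + m₁ * f₃ + f₁ * m₁ * f₃)) := by
    have e1 : exp (-WA) = 1 + f₁ := by rw [hf₁]; abel
    have e3 : exp WA'' = 1 + f₃ := by rw [hf₃]; abel
    have em : (M₀ : 𝔸) = 1 + m₁ := by rw [hm₁]; abel
    rw [e1, e3, em]; noncomm_ring
  have hlin : m₁ - PA + PA'' = ∑ r : Fin d → Fin L, ((L : ℝ) ^ d)⁻¹ •
      (m₁ - (((A r : 𝔸ˣ) : 𝔸) - 1) + ((((Rc S (A' r) : 𝔸ˣ)) : 𝔸) - 1)) := by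
    simp only [smul_add, smul_sub, Finset.sum_add_distrib, Finset.sum_sub_distrib, ← Finset.sum_smul,
      sum_weights L hL, one_smul, hPA, hPA'']
  have hbr : ∀ r, ‖m₁ - (((A r : 𝔸ˣ) : 𝔸) - 1) + ((((Rc S (A' r) : 𝔸ˣ)) : 𝔸) - 1)‖ ≤ δ + (2 * a * δ + ε) :=
    fun r => by
    have hid : m₁ - (((A r : 𝔸ˣ) : 𝔸) - 1) + ((((Rc S (A' r) : 𝔸ˣ)) : 𝔸) - 1) =
        ((((Rc (h₁ r) (D r) : 𝔸ˣ)) : 𝔸) - 1) +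
          (m₁ - (((A r : 𝔸ˣ) : 𝔸) - 1) + ((((Rc S (A' r) : 𝔸ˣ)) : 𝔸) - 1) - ((((Rc (h₁ r) (D r) : 𝔸ˣ)) : 𝔸) - 1)) := by
      abel
    rw [hid]
    exact (norm_add_le _ _).trans (add_le_add (hRD r) (hJ r))
  have hlin_n : ‖m₁ - PA + PA''‖ ≤ δ + (2 * a * δ + ε) := by
    rw [hlin]
    have h := norm_wsum_le Finset.univ (fun _ : Fin d → Fin L => ((L : ℝ) ^ d)⁻¹) (fun _ _ => hc0) _
      (fun r _ => hbr r)
    rw [sum_weights L hL, one_mul] at h; exact h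
  have hprod : ‖f₁ * m₁ + f₁ * f₃ + m₁ * f₃ + f₁ * m₁ * f₃‖ ≤ f * δ + f * f + δ * f + f * δ * f := by
    calc _ ≤ ‖f₁ * m₁‖ + ‖f₁ * f₃‖ + ‖m₁ * f₃‖ + ‖f₁ * m₁ * f₃‖ := norm_add₄_le
      _ ≤ ‖f₁‖ * ‖m₁‖ + ‖f₁‖ * ‖f₃‖ + ‖m₁‖ * ‖f₃‖ + ‖f₁‖ * ‖m₁‖ * ‖f₃‖ :=
          add_le_add (add_le_add (add_le_add (norm_mul_le _ _) (norm_mul_le _ _)) (norm_mul_le _ _))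
            norm_mul₃_le
      _ ≤ f * δ + f * f + δ * f + f * δ * f :=
          add_le_add (add_le_add (add_le_add (mul_le_mul hf₁n hM (norm_nonneg _) hf0)
            (mul_le_mul hf₁n hf₃n (norm_nonneg _) hf0)) (mul_le_mul hM hf₃n (norm_nonneg _) hδ0))
            (mul_le_mul (mul_le_mul hf₁n hM (norm_nonneg _) hf0) hf₃n (norm_nonneg _) (by positivity))
  -- assembly
  rw [hT0, hT0id]
  have hw13 : 13 * w₀ * α₄ = 13 * (16 * ((d : ℝ) + 1) * ((d : ℝ) + 4) * L ^ 2 * α₀) * α₄ := by rw [hw₀]; ring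
  have hnum := numerics_T0 (dd := (d : ℝ)) hd1 hℓ0 hdℓ haℓ hδ0 le_rfl hf0 (le_of_eq hf)
  calc _ ≤ ‖m₁ - PA + PA''‖ + (‖f₁ + PA‖ + ‖f₃ - PA''‖ + ‖f₁ * m₁ + f₁ * f₃ + m₁ * f₃ + f₁ * m₁ * f₃‖) := by
        refine (norm_add_le _ _).trans (add_le_add le_rfl ?_)
        exact (norm_add_le _ _).trans (add_le_add (norm_add_le _ _) le_rfl)
    _ ≤ (δ + (2 * a * δ + ε)) + (6 * a ^ 2 + 6 * a ^ 2 + (f * δ + f * f + δ * f + f * δ * f)) :=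
        add_le_add hlin_n (add_le_add (add_le_add hE1m hE1p) hprod)
    _ = (δ + 2 * a * δ + 12 * a ^ 2 + 2 * f * δ + f ^ 2 + f ^ 2 * δ) + 13 * w₀ * α₄ := by rw [hε]; ring
    _ ≤ (ℓ + 70 * (d : ℝ) ^ 2 * ℓ ^ 2) + 13 * w₀ * α₄ := by linarith
    _ = _ := by rw [hw13, hℓ]

end Step2

/-! ## §5 (188)/(199): the averaged transporter `R̄_{0,c} = R(V̄₀(c))`, `V̄₀(c) = e^{X_c}V₀(c)`, and the assembly of (199) -/

section Assembly

/-- crude size of the exponent (78) of `\overline{R₀v}(y)`: `‖Σ_x L^{−d} log v(y)⁻¹(R_{0,y}v)(x)‖ ≤ (22/5)α₄` for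
`‖v − 1‖ ≤ α₄ ≤ 1/20` (each block quantity has `‖· − 1‖ ≤ (11/5)α₄`, `norm_cov_sub_one_crude`).
[cite: Balaban1985Averaging, (78) p.30, (194) p.48] -/
theorem norm_Sexp_R0fun_le_crude {L : ℕ} (hL : 1 ≤ L) {V₀ : Site d → Fin d → 𝔸ˣ} (hV : ∀ x κ, V₀ x κ ∈ U1 𝔸)
    {v : Site d → 𝔸ˣ} {α₄ : ℝ} (hv : SiteBd v α₄) (hα₄ : α₄ ≤ 1 / 20) (y : Site d) :
    ‖Sexp L (R0fun V₀ y v) y‖ ≤ 22 / 5 * α₄ := by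
  rw [Sexp_apply]
  refine norm_avg_le L hL _ fun r => ?_
  rw [R0fun_self, R0fun_add]
  have h := norm_cov_sub_one_crude (hol_mem hV y (treeWord (boxVec L r))) hv hα₄ y (y + boxVec L r)
  have hα0 : 0 ≤ α₄ := (norm_nonneg _).trans (hv y)
  calc _ ≤ 2 * ‖((((v y)⁻¹ * Rc (hol V₀ y (treeWord (boxVec L r))) (v (y + boxVec L r)) : 𝔸ˣ)) : 𝔸) - 1‖ :=
        norm_mlog_le_two_mul (h.trans (by linarith))
    _ ≤ 2 * (11 / 5 * α₄) := by gcongr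
    _ = 22 / 5 * α₄ := by ring

/-- **crude size of the twisted average itself**: `‖\overline{R₀v}(y) − 1‖ ≤ 7α₄` and `‖\overline{R₀v}(y)⁻¹‖ ≤ 3/2` for
`‖v − 1‖ ≤ α₄ ≤ 1/20` — independent of `L` and of the bond constant (the size used whenever a quantity is only ROTATED,
cf. print p. 47 "`R̄_{0,c}v′(c₊) = R(V₀(c))v′(c₊) + O(L²α₀|v′(c₊) − 1|)`"). [cite: Balaban1985Averaging, (78) p.30, p.47] -/
theorem norm_R0avg_crude {L : ℕ} (hL : 1 ≤ L) {V₀ : Site d → Fin d → 𝔸ˣ} (hV : ∀ x κ, V₀ x κ ∈ U1 𝔸)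
    {v : Site d → 𝔸ˣ} {α₄ : ℝ} (hv : SiteBd v α₄) (hα₄ : α₄ ≤ 1 / 20) (y : Site d) :
    ‖((R0avg L V₀ v y : 𝔸ˣ) : 𝔸) - 1‖ ≤ 7 * α₄ ∧ ‖(((R0avg L V₀ v y)⁻¹ : 𝔸ˣ) : 𝔸)‖ ≤ 3 / 2 := by
  have hα0 : 0 ≤ α₄ := (norm_nonneg _).trans (hv y)
  have hS := norm_Sexp_R0fun_le_crude hL hV hv hα₄ y
  set X : 𝔸 := Sexp L (R0fun V₀ y v) y with hX
  have hexp : ∀ Z : 𝔸, ‖Z‖ ≤ 22 / 5 * α₄ → ‖exp Z - 1‖ ≤ 11 / 2 * α₄ := fun Z hZ => by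
    have h1 := (norm_exp_sub_one_le_of_norm_le hZ).1
    have h2 := real_exp_sub_one_le (t := 22 / 5 * α₄) (by positivity) (by linarith)
    nlinarith
  have hval : ((R0avg L V₀ v y : 𝔸ˣ) : 𝔸) = (v y : 𝔸) * exp X := by
    rw [R0avg, savg_apply, R0fun_self, Units.val_mul, val_expUnit]
  have hinv : (((R0avg L V₀ v y)⁻¹ : 𝔸ˣ) : 𝔸) = exp (-X) * (((v y)⁻¹ : 𝔸ˣ) : 𝔸) := by
    rw [R0avg, savg_apply, R0fun_self, mul_inv_rev, Units.val_mul, val_inv_expUnit, val_expUnit]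
  constructor
  · rw [hval]
    have hid : (v y : 𝔸) * exp X - 1 = (((v y : 𝔸ˣ) : 𝔸) - 1) * exp X + (exp X - 1) := by noncomm_ring
    rw [hid]
    have he := hexp X hS
    have hen : ‖exp X‖ ≤ 1 + 11 / 2 * α₄ := (norm_le_one_add' _).trans (by linarith)
    calc _ ≤ ‖((v y : 𝔸ˣ) : 𝔸) - 1‖ * ‖exp X‖ + ‖exp X - 1‖ :=
          (norm_add_le _ _).trans (add_le_add (norm_mul_le _ _) le_rfl)
      _ ≤ α₄ * (1 + 11 / 2 * α₄) + 11 / 2 * α₄ :=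
          add_le_add (mul_le_mul (hv y) hen (norm_nonneg _) hα0) he
      _ ≤ 7 * α₄ := by nlinarith
  · rw [hinv]
    have he := hexp (-X) (by rwa [norm_neg])
    have hen : ‖exp (-X)‖ ≤ 1 + 11 / 2 * α₄ := (norm_le_one_add' _).trans (by linarith)
    have hvi : ‖(((v y)⁻¹ : 𝔸ˣ) : 𝔸)‖ ≤ 1 + 2 * α₄ :=
      (norm_le_one_add' _).trans (by linarith [norm_units_inv_sub_one_le (v y) ((hv y).trans (by linarith)), hv y])
    calc _ ≤ ‖exp (-X)‖ * ‖(((v y)⁻¹ : 𝔸ˣ) : 𝔸)‖ := norm_mul_le _ _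
      _ ≤ (1 + 11 / 2 * α₄) * (1 + 2 * α₄) := mul_le_mul hen hvi (norm_nonneg _) (by positivity)
      _ ≤ 3 / 2 := by nlinarith

set_option maxHeartbeats 400000 in
/-- **(199) AT A GENERAL BACKGROUND, IN PRINT'S SHAPE — itemised constants.**  With `y = Lz`, `y′ = L(z + e_μ)`, `c = ⟨y, y′⟩`,
`R̄_{0,c} = R(V̄₀(c))`, `V̄₀ = \overline{V₀}` the averaged configuration (42)/(43) (`B7Prop1Explicit.bavg L V₀`, `V̄₀(c) =
e^{X_c}V₀(c)`), `ṽ′ = B7Prop9General.vtilG`: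
`‖ṽ′(c₋)⁻¹R̄_{0,c}ṽ′(c₊) − 1‖ ≤ Lα′₄ + 370d²L²α′₄² + 139·16(d+1)(d+4)L²α₀α₄ + 150dL²α′₃α′₄`.
PROOF = print's (181)–(197) in three steps: (a) (184) `ṽ′ ≈ \overline{R₀v′}` to within `15(a² + aβ)`, `a = 2dLα′₄`,
`β = Lα′₃` (`norm_vtilG_sub_R0avg_le`); (b) p. 47 "`V̄_{0,c} = e^{iO(L²α₀)}V₀(c)`, hence `R̄_{0,c}(·) = R(V₀(c))(·) + O(L²α₀·|· − 1|)`"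
(`‖X_c‖ ≤ 32(d+1)(d+4)L²α₀`, `B7Prop2Explicit.norm_Wcx_sub_one_le`; `B7Prop9General.norm_Rc_expUnit_sub_self_le`) applied to
the CRUDE size `‖\overline{R₀v′}(c₊) − 1‖ ≤ 7α₄` (`norm_R0avg_crude`); (c) (186)–(197) for `\overline{R₀v′}`
(`norm_coarse_R0avg_sub_one_le`).  Hypotheses: `V₀` in `U1` with (52) `‖V₀(∂p) − 1‖ ≤ α₀` and Prop. 2's
`512(d+1)(d+4)L²α₀ ≤ 1`; (180): `‖v′ − 1‖ ≤ α₄ ≤ 1/20`, `CovBondBd V₀ v′ α′₄` with `100dLα′₄ ≤ 1`, `‖v₁ − 1‖ ≤ α₃ ≤ 1/50`,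
`CovBlockBd L V₀ v₁ (Lα′₃)` with `50Lα′₃ ≤ 1` (print's `c′₆`, depending on `d` and `L`, as in the lineage).
[cite: Balaban1985Averaging, Proposition 9 (199) p.49, (181)–(197) pp.46–49, (42)–(43) pp.23–24] -/
theorem eq199_printed_terms {L : ℕ} (hL : 1 ≤ L) {V₀ : Site d → Fin d → 𝔸ˣ} (hV : ∀ x κ, V₀ x κ ∈ U1 𝔸)
    {α₀ : ℝ} (hα₀ : 0 ≤ α₀)
    (h44 : ∀ (x : Site d) (κ μ : Fin d), κ ≠ μ → ‖((hol V₀ x (plaqWord κ μ) : 𝔸ˣ) : 𝔸) - 1‖ ≤ α₀)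
    {v' v₁ : Site d → 𝔸ˣ} {α₃ α₃' α₄ α₄' : ℝ}
    (h4a : SiteBd v' α₄) (h4b : CovBondBd V₀ v' α₄') (h3c : SiteBd v₁ α₃) (h3d : CovBlockBd L V₀ v₁ (L * α₃'))
    (hα₄ : α₄ ≤ 1 / 20) (hα₄' : 0 ≤ α₄') (hα₃ : α₃ ≤ 1 / 50) (hα₃' : 50 * (L * α₃') ≤ 1)
    (hs : 100 * ((d : ℝ) * L * α₄') ≤ 1) (hα₀s : 512 * ((d : ℝ) + 1) * ((d : ℝ) + 4) * L ^ 2 * α₀ ≤ 1)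
    (z : Site d) (μ : Fin d) :
    ‖((((vtilG L V₀ v' v₁ ((L : ℤ) • z))⁻¹ *
        Rc (bavg L V₀ ((L : ℤ) • z) μ) (vtilG L V₀ v' v₁ ((L : ℤ) • (z + e μ))) : 𝔸ˣ)) : 𝔸) - 1‖
      ≤ L * α₄' + 370 * (d : ℝ) ^ 2 * (L ^ 2 * α₄' ^ 2) + 139 * (16 * ((d : ℝ) + 1) * ((d : ℝ) + 4) * L ^ 2 * α₀) * α₄ +
        150 * (d : ℝ) * (L ^ 2 * (α₃' * α₄')) := by
  have hL0 : 0 < L := lt_of_lt_of_le zero_lt_one hL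
  have hLr : (1 : ℝ) ≤ L := by exact_mod_cast hL
  have hd1 : (1 : ℝ) ≤ d := by exact_mod_cast Nat.succ_le_of_lt μ.pos
  have hα₄0 : 0 ≤ α₄ := (norm_nonneg _).trans (h4a 0)
  have hβ : L * α₃' ≤ 1 / 50 := by linarith
  have hβ0 : 0 ≤ L * α₃' := (norm_nonneg _).trans (h3d z fun _ => ⟨0, hL0⟩)
  have hs24 : 24 * ((d : ℝ) * L * α₄') ≤ 1 := by
    have : 0 ≤ (d : ℝ) * L * α₄' := by positivity
    linarith
  -- the three inputs
  have h2 := norm_coarse_R0avg_sub_one_le hL hV hα₀ h44 h4a h4b hα₄ hα₄' hs hα₀s z μ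
  have h0 := norm_vtilG_sub_R0avg_le hL hV h4a h4b h3c h3d hα₄ hα₄' hα₃ hβ hs24 z
  have h0' := norm_vtilG_sub_R0avg_le hL hV h4a h4b h3c h3d hα₄ hα₄' hα₃ hβ hs24 (z + e μ)
  have h200 := eq200_printed hL hV h4a h4b h3c h3d (hα₄.trans (by norm_num)) hα₄' hα₃ hβ hs z
  have hG' := norm_R0avg_crude hL hV h4a hα₄ ((L : ℤ) • (z + e μ))
  have hG := norm_R0avg_crude hL hV h4a hα₄ ((L : ℤ) • z)
  have hqq : (L : ℤ) • (z + e μ) = (L : ℤ) • z + (L : ℤ) • e μ := smul_add _ _ _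
  rw [hqq] at h2 h0' hG' ⊢
  set q : Site d := (L : ℤ) • z with hq
  set q' : Site d := q + (L : ℤ) • e μ with hq'
  set S : 𝔸ˣ := hol V₀ q (seg μ L) with hSdef
  set E : 𝔸ˣ := expUnit (Xavg L V₀ q μ) with hE
  have hS : S ∈ U1 𝔸 := hol_mem hV _ _
  have hbavg : bavg L V₀ q μ = E * S := rfl
  set a : ℝ := 2 * ((d : ℝ) * L * α₄') with ha
  set w : ℝ := 16 * ((d : ℝ) + 1) * ((d : ℝ) + 4) * L ^ 2 * α₀ with hw
  set δ₀ : ℝ := 15 * (a ^ 2 + a * (L * α₃')) with hδ₀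
  have ha0 : 0 ≤ a := by rw [ha]; positivity
  have ha1 : a ≤ 1 / 50 := by rw [ha]; linarith
  have hw0 : 0 ≤ w := by rw [hw]; positivity
  have hw1 : w ≤ 1 / 32 := by
    have : w = 1 / 32 * (512 * ((d : ℝ) + 1) * ((d : ℝ) + 4) * L ^ 2 * α₀) := by rw [hw]; ring
    rw [this]; linarith
  have hδ₀0 : 0 ≤ δ₀ := by rw [hδ₀]; positivity
  -- names
  set tv : 𝔸ˣ := vtilG L V₀ v' v₁ q with htv
  set tv' : 𝔸ˣ := vtilG L V₀ v' v₁ q' with htv'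
  set G : 𝔸ˣ := R0avg L V₀ v' q with hGdef
  set G' : 𝔸ˣ := R0avg L V₀ v' q' with hG'def
  -- the exponent `X_c` of the averaged bond is `O(L²α₀)`
  have hX : ‖Xavg L V₀ q μ‖ ≤ 2 * w := by
    unfold Xavg
    refine norm_avg_le L hL _ fun r => ?_
    have hW := B7Prop2Explicit.norm_Wcx_sub_one_le L hL V₀ hV hα₀ hα₀s h44 q μ r
    have hW' : ‖((Wcx L V₀ q μ (boxVec L r) : 𝔸ˣ) : 𝔸) - 1‖ ≤ 1 / 2 := hW.trans (by rw [hw] at hw1; linarith)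
    calc _ ≤ 2 * ‖((Wcx L V₀ q μ (boxVec L r) : 𝔸ˣ) : 𝔸) - 1‖ := norm_mlog_le_two_mul hW'
      _ ≤ 2 * (2 * (8 * ((d : ℝ) + 1) * ((d : ℝ) + 4) * (L : ℝ) ^ 2 * α₀)) := by linarith
      _ = 2 * w := by rw [hw]; ring
  -- sizes
  have htv1 : ‖(tv : 𝔸) - 1‖ ≤ 11 / 100 := by
    refine h200.trans ?_
    have : 6 * (d : ℝ) * L * α₄' ≤ 6 / 100 := by
      have : 0 ≤ (d : ℝ) * L * α₄' := by positivity
      linarith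
    linarith
  have htvi : ‖((tv⁻¹ : 𝔸ˣ) : 𝔸)‖ ≤ 61 / 50 :=
    (norm_le_one_add' _).trans (by linarith [norm_units_inv_sub_one_le tv (htv1.trans (by norm_num))])
  have hGi : ‖((G⁻¹ : 𝔸ˣ) : 𝔸)‖ ≤ 3 / 2 := hG.2
  have hG'1 : ‖(G' : 𝔸) - 1‖ ≤ 7 * α₄ := hG'.1
  have hG'n : ‖(G' : 𝔸)‖ ≤ 1 + 7 * α₄ := (norm_le_one_add' _).trans (by linarith)
  have hew : Real.exp (2 * w) - 1 ≤ 1 / 10 := by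
    have h2 := real_exp_sub_one_le (t := 2 * w) (by positivity) (by linarith)
    have h3 : (2 * w) ^ 2 ≤ 1 / 16 * (2 * w) := by
      rw [sq]; exact mul_le_mul_of_nonneg_right (by linarith) (by positivity)
    linarith
  have hEn : ‖(E : 𝔸)‖ ≤ 11 / 10 := by
    rw [hE, val_expUnit]
    have h := (norm_exp_sub_one_le_of_norm_le hX).1
    exact (norm_le_one_add' _).trans (by linarith)
  have hEin : ‖((E⁻¹ : 𝔸ˣ) : 𝔸)‖ ≤ 11 / 10 := by
    rw [hE, val_inv_expUnit, val_expUnit]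
    have h := (norm_exp_sub_one_le_of_norm_le (show ‖-Xavg L V₀ q μ‖ ≤ 2 * w by rwa [norm_neg])).1
    exact (norm_le_one_add' _).trans (by linarith)
  -- conjugation by `E·S` costs a factor `(11/10)²`
  set P : 𝔸 := ((E * S : 𝔸ˣ) : 𝔸) with hP
  set Pi : 𝔸 := (((E * S)⁻¹ : 𝔸ˣ) : 𝔸) with hPi
  have hPn : ‖P‖ ≤ 11 / 10 := by
    rw [hP, Units.val_mul]
    refine (norm_mul_le _ _).trans ?_
    calc ‖(E : 𝔸)‖ * ‖(S : 𝔸)‖ ≤ 11 / 10 * 1 := mul_le_mul hEn (mem_U1.mp hS).1 (norm_nonneg _) (by norm_num)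
      _ = 11 / 10 := by norm_num
  have hPin : ‖Pi‖ ≤ 11 / 10 := by
    rw [hPi, mul_inv_rev, Units.val_mul]
    refine (norm_mul_le _ _).trans ?_
    calc ‖((S⁻¹ : 𝔸ˣ) : 𝔸)‖ * ‖((E⁻¹ : 𝔸ˣ) : 𝔸)‖ ≤ 1 * (11 / 10) :=
          mul_le_mul (mem_U1.mp hS).2 hEin (norm_nonneg _) (by norm_num)
      _ = 11 / 10 := by norm_num
  have hconj : ∀ Z : 𝔸, ‖P * Z * Pi‖ ≤ 121 / 100 * ‖Z‖ := fun Z => by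
    calc _ ≤ ‖P‖ * ‖Z‖ * ‖Pi‖ := norm_mul₃_le
      _ ≤ 11 / 10 * ‖Z‖ * (11 / 10) := by gcongr
      _ = 121 / 100 * ‖Z‖ := by ring
  -- (a) `T − T₁`
  have hT : ((((tv⁻¹ * Rc (E * S) tv') : 𝔸ˣ)) : 𝔸) = ((tv⁻¹ : 𝔸ˣ) : 𝔸) * (P * (tv' : 𝔸) * Pi) := by
    rw [Units.val_mul, Rc_apply, Units.val_mul, Units.val_mul]
  set T₁ : 𝔸 := ((G⁻¹ : 𝔸ˣ) : 𝔸) * (P * (G' : 𝔸) * Pi) with hT₁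
  have hTT₁ : ‖((tv⁻¹ : 𝔸ˣ) : 𝔸) * (P * (tv' : 𝔸) * Pi) - T₁‖ ≤ 5 * δ₀ := by
    have hid : ((tv⁻¹ : 𝔸ˣ) : 𝔸) * (P * (tv' : 𝔸) * Pi) - T₁ =
        ((tv⁻¹ : 𝔸ˣ) : 𝔸) * (P * ((tv' : 𝔸) - (G' : 𝔸)) * Pi) +
          (((tv⁻¹ : 𝔸ˣ) : 𝔸) - ((G⁻¹ : 𝔸ˣ) : 𝔸)) * (P * (G' : 𝔸) * Pi) := by
      rw [hT₁]; noncomm_ring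
    have hdi : ((tv⁻¹ : 𝔸ˣ) : 𝔸) - ((G⁻¹ : 𝔸ˣ) : 𝔸) = ((tv⁻¹ : 𝔸ˣ) : 𝔸) * ((G : 𝔸) - (tv : 𝔸)) * ((G⁻¹ : 𝔸ˣ) : 𝔸) := by
      rw [mul_sub, sub_mul, Units.mul_inv_cancel_right, Units.inv_mul, one_mul]
    have hdin : ‖((tv⁻¹ : 𝔸ˣ) : 𝔸) - ((G⁻¹ : 𝔸ˣ) : 𝔸)‖ ≤ 61 / 50 * δ₀ * (3 / 2) := by
      rw [hdi]
      calc _ ≤ ‖((tv⁻¹ : 𝔸ˣ) : 𝔸)‖ * ‖(G : 𝔸) - (tv : 𝔸)‖ * ‖((G⁻¹ : 𝔸ˣ) : 𝔸)‖ := norm_mul₃_le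
        _ ≤ 61 / 50 * δ₀ * (3 / 2) := by
            refine mul_le_mul (mul_le_mul htvi ?_ (norm_nonneg _) (by norm_num)) hGi (norm_nonneg _) (by positivity)
            rw [norm_sub_rev]; exact h0
    rw [hid]
    calc _ ≤ ‖((tv⁻¹ : 𝔸ˣ) : 𝔸) * (P * ((tv' : 𝔸) - (G' : 𝔸)) * Pi)‖ +
          ‖(((tv⁻¹ : 𝔸ˣ) : 𝔸) - ((G⁻¹ : 𝔸ˣ) : 𝔸)) * (P * (G' : 𝔸) * Pi)‖ := norm_add_le _ _
      _ ≤ 61 / 50 * (121 / 100 * δ₀) + 61 / 50 * δ₀ * (3 / 2) * (121 / 100 * (1 + 7 * α₄)) := by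
          refine add_le_add ((norm_mul_le _ _).trans (mul_le_mul htvi ((hconj _).trans ?_) (norm_nonneg _)
            (by norm_num))) ((norm_mul_le _ _).trans (mul_le_mul hdin ((hconj _).trans ?_) (norm_nonneg _)
            (by positivity)))
          · exact mul_le_mul_of_nonneg_left h0' (by norm_num)
          · exact mul_le_mul_of_nonneg_left hG'n (by norm_num)
      _ ≤ 5 * δ₀ := by
          have : δ₀ * α₄ ≤ δ₀ * (1 / 20) := mul_le_mul_of_nonneg_left hα₄ hδ₀0
          linarith
  -- (b) `T₁ − T₀`: the rotation `R(e^{X_c})` moved through the crude size of `\overline{R₀v′}(c₊)`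
  set Y : 𝔸ˣ := Rc S G' with hY
  set T₀ : 𝔸 := ((G⁻¹ * Rc S G' : 𝔸ˣ) : 𝔸) with hT₀
  have hT₁' : T₁ = ((G⁻¹ : 𝔸ˣ) : 𝔸) * ((Rc E Y : 𝔸ˣ) : 𝔸) := by
    rw [hT₁, hY, hP, hPi, Rc_apply, Rc_apply]
    simp only [Units.val_mul, mul_inv_rev, mul_assoc]
  have hY1 : ‖(Y : 𝔸) - 1‖ ≤ 7 * α₄ := by
    rw [hY, Rc_apply, Units.val_mul, Units.val_mul]; exact (norm_units_conj_sub_one_le hS _).trans hG'1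
  have hT₁T₀ : ‖T₁ - T₀‖ ≤ 126 * w * α₄ := by
    have hid : T₁ - T₀ = ((G⁻¹ : 𝔸ˣ) : 𝔸) * (((Rc E Y : 𝔸ˣ) : 𝔸) - (Y : 𝔸)) := by
      rw [hT₁', hT₀, Units.val_mul, ← hY, mul_sub]
    rw [hid]
    have hmove := norm_Rc_expUnit_sub_self_le hX (by linarith) Y
    calc _ ≤ ‖((G⁻¹ : 𝔸ˣ) : 𝔸)‖ * ‖((Rc E Y : 𝔸ˣ) : 𝔸) - (Y : 𝔸)‖ := norm_mul_le _ _
      _ ≤ 3 / 2 * (6 * (2 * w) * (7 * α₄)) := by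
          refine mul_le_mul hGi (hmove.trans ?_) (norm_nonneg _) (by norm_num)
          exact mul_le_mul_of_nonneg_left hY1 (by positivity)
      _ = 126 * w * α₄ := by ring
  -- (c) and the sum
  have hT₀1 : ‖T₀ - 1‖ ≤ L * α₄' + 70 * (d : ℝ) ^ 2 * (L * α₄') ^ 2 + 13 * w * α₄ := by rw [hT₀, hw]; exact h2
  rw [hbavg, hT]
  have hid : ((tv⁻¹ : 𝔸ˣ) : 𝔸) * (P * (tv' : 𝔸) * Pi) - 1 =
      (((tv⁻¹ : 𝔸ˣ) : 𝔸) * (P * (tv' : 𝔸) * Pi) - T₁) + (T₁ - T₀) + (T₀ - 1) := by abel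
  rw [hid]
  have ha2 : a ^ 2 = 4 * (d : ℝ) ^ 2 * (L ^ 2 * α₄' ^ 2) := by rw [ha]; ring
  have haβ : a * (L * α₃') = 2 * (d : ℝ) * (L ^ 2 * (α₃' * α₄')) := by rw [ha]; ring
  calc _ ≤ ‖((tv⁻¹ : 𝔸ˣ) : 𝔸) * (P * (tv' : 𝔸) * Pi) - T₁‖ + ‖T₁ - T₀‖ + ‖T₀ - 1‖ := norm_add₃_le
    _ ≤ 5 * δ₀ + 126 * w * α₄ + (L * α₄' + 70 * (d : ℝ) ^ 2 * (L * α₄') ^ 2 + 13 * w * α₄) :=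
        add_le_add (add_le_add hTT₁ hT₁T₀) hT₀1
    _ = L * α₄' + 370 * (d : ℝ) ^ 2 * (L ^ 2 * α₄' ^ 2) + 139 * w * α₄ + 150 * (d : ℝ) * (L ^ 2 * (α₃' * α₄')) := by
        rw [hδ₀, ha2, haβ]; ring
    _ = _ := by rw [hw]

/-- **PROPOSITION 9 (199) AT A GENERAL BACKGROUND, AS PRINTED** (p. 49: "There exist positive constants `C′₄, C′₅, c′₆` such
that for arbitrary functions `V₀, v′, v₁` satisfying (180) with `α₀, α₃, α′₃, α₄, α′₄ ≦ c′₆`, the following bounds hold: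
`|ṽ′⁻¹(c₋)R̄_{0,c}ṽ′(c₊) − 1| < Lα′₄ + C′₄L²(α₀α₄ + α′₃α′₄ + α′₄²)`, (199)"), kernel form over the concrete model with
`C′₄ = C′₄(d) = 2400(d+1)(d+4)` — INDEPENDENT OF `L`, no `α₀α′₄`-term, no "`α′₄ = O(α₄)`" proviso — and `c′₆ = c′₆(d, L)` explicit
(`α₄ ≤ 1/20`, `100dLα′₄ ≤ 1`, `α₃ ≤ 1/50`, `50Lα′₃ ≤ 1`, `512(d+1)(d+4)L²α₀ ≤ 1`).  This removes READING (b) of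
`B7Prop9General.eq199_general` ("`C′₄L²·α₀α₄` is here `16(d+1)²L³α₀α₄ + …`"): the covariant proof pays each rotation discrepancy as
`L²α₀` times the crude size `O(α₄)` (print's (194)), never times the `O(Lα′₄)` of (182).  READINGS kept: `U1`-valued background
and Banach `|·|` (lineage), `≤` for `<`, blocks `B(Lz) = Lz + [0,L)^d`, tree contours `B7Prop1Explicit.treeWord`.
[cite: Balaban1985Averaging, Proposition 9 (199) p.49, (180)–(197) pp.46–49] -/
theorem eq199_printed {L : ℕ} (hL : 1 ≤ L) {V₀ : Site d → Fin d → 𝔸ˣ} (hV : ∀ x κ, V₀ x κ ∈ U1 𝔸)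
    {α₀ : ℝ} (hα₀ : 0 ≤ α₀)
    (h44 : ∀ (x : Site d) (κ μ : Fin d), κ ≠ μ → ‖((hol V₀ x (plaqWord κ μ) : 𝔸ˣ) : 𝔸) - 1‖ ≤ α₀)
    {v' v₁ : Site d → 𝔸ˣ} {α₃ α₃' α₄ α₄' : ℝ}
    (h4a : SiteBd v' α₄) (h4b : CovBondBd V₀ v' α₄') (h3c : SiteBd v₁ α₃) (h3d : CovBlockBd L V₀ v₁ (L * α₃'))
    (hα₄ : α₄ ≤ 1 / 20) (hα₄' : 0 ≤ α₄') (hα₃ : α₃ ≤ 1 / 50) (hα₃' : 50 * (L * α₃') ≤ 1)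
    (hs : 100 * ((d : ℝ) * L * α₄') ≤ 1) (hα₀s : 512 * ((d : ℝ) + 1) * ((d : ℝ) + 4) * L ^ 2 * α₀ ≤ 1)
    (z : Site d) (μ : Fin d) :
    ‖((((vtilG L V₀ v' v₁ ((L : ℤ) • z))⁻¹ *
        Rc (bavg L V₀ ((L : ℤ) • z) μ) (vtilG L V₀ v' v₁ ((L : ℤ) • (z + e μ))) : 𝔸ˣ)) : 𝔸) - 1‖
      ≤ L * α₄' + 2400 * ((d : ℝ) + 1) * ((d : ℝ) + 4) * L ^ 2 * (α₀ * α₄ + α₃' * α₄' + α₄' ^ 2) := by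
  have hL0 : 0 < L := lt_of_lt_of_le zero_lt_one hL
  have h := eq199_printed_terms hL hV hα₀ h44 h4a h4b h3c h3d hα₄ hα₄' hα₃ hα₃' hs hα₀s z μ
  refine h.trans ?_
  have hd : (0 : ℝ) ≤ d := Nat.cast_nonneg d
  have hα₄0 : 0 ≤ α₄ := (norm_nonneg _).trans (h4a 0)
  have hβ0 : 0 ≤ L * α₃' := (norm_nonneg _).trans (h3d z fun _ => ⟨0, hL0⟩)
  have hL2 : (0 : ℝ) ≤ L ^ 2 := by positivity
  have h34 : 0 ≤ α₃' * α₄' := by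
    have hLr : (0 : ℝ) < L := by exact_mod_cast hL0
    have : 0 ≤ α₃' := by nlinarith
    exact mul_nonneg this hα₄'
  have e1 : 370 * (d : ℝ) ^ 2 ≤ 2400 * ((d : ℝ) + 1) * ((d : ℝ) + 4) := by nlinarith
  have e2 : 139 * (16 * ((d : ℝ) + 1) * ((d : ℝ) + 4)) ≤ 2400 * ((d : ℝ) + 1) * ((d : ℝ) + 4) := by nlinarith
  have e3 : 150 * (d : ℝ) ≤ 2400 * ((d : ℝ) + 1) * ((d : ℝ) + 4) := by nlinarith
  have m1 : 0 ≤ L ^ 2 * α₄' ^ 2 := by positivity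
  have m2 : 0 ≤ (L : ℝ) ^ 2 * α₀ * α₄ := by positivity
  have m3 : 0 ≤ (L : ℝ) ^ 2 * (α₃' * α₄') := mul_nonneg hL2 h34
  nlinarith [mul_le_mul_of_nonneg_right e1 m1, mul_le_mul_of_nonneg_right e2 m2, mul_le_mul_of_nonneg_right e3 m3]

/-- **PROPOSITION 9 AT A GENERAL BACKGROUND WITH PRINT'S SHAPES, packaged as the hypotheses (180b)/(180a) ONE SCALE UP** (the
input of the induction (201)–(206) of Proposition 10): the coarse function `z ↦ ṽ′(Lz)` satisfies `CovBondBd` at the averaged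
background `B7Prop2Explicit.rescale L (B7Prop1Explicit.bavg L V₀)` (= `avgIter L V₀ 1`) with the constant of `eq199_printed`,
`Lα′₄ + C′₄L²(α₀α₄ + α′₃α′₄ + α′₄²)`, `C′₄ = 2400(d+1)(d+4)`, and `SiteBd` with the constant of `B7Ineq200General.eq200_printed`,
`α₄ + 6dLα′₄` (print's (200) `α₄ + C′₅Lα′₄`, no `α₀`-term).  Compare `B7Prop9General.prop9_general` (same packaging, constants with
one extra power of `L` on the `α₀`-terms). [cite: Balaban1985Averaging, Proposition 9 p.49, (199)–(200) p.49, (180) p.46] -/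
theorem prop9_printed {L : ℕ} (hL : 1 ≤ L) {V₀ : Site d → Fin d → 𝔸ˣ} (hV : ∀ x κ, V₀ x κ ∈ U1 𝔸)
    {α₀ : ℝ} (hα₀ : 0 ≤ α₀)
    (h44 : ∀ (x : Site d) (κ μ : Fin d), κ ≠ μ → ‖((hol V₀ x (plaqWord κ μ) : 𝔸ˣ) : 𝔸) - 1‖ ≤ α₀)
    {v' v₁ : Site d → 𝔸ˣ} {α₃ α₃' α₄ α₄' : ℝ}
    (h4a : SiteBd v' α₄) (h4b : CovBondBd V₀ v' α₄') (h3c : SiteBd v₁ α₃) (h3d : CovBlockBd L V₀ v₁ (L * α₃'))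
    (hα₄ : α₄ ≤ 1 / 20) (hα₄' : 0 ≤ α₄') (hα₃ : α₃ ≤ 1 / 50) (hα₃' : 50 * (L * α₃') ≤ 1)
    (hs : 100 * ((d : ℝ) * L * α₄') ≤ 1) (hα₀s : 512 * ((d : ℝ) + 1) * ((d : ℝ) + 4) * L ^ 2 * α₀ ≤ 1) :
    CovBondBd (B7Prop2Explicit.rescale L (bavg L V₀)) (fun z => vtilG L V₀ v' v₁ ((L : ℤ) • z))
        (L * α₄' + 2400 * ((d : ℝ) + 1) * ((d : ℝ) + 4) * L ^ 2 * (α₀ * α₄ + α₃' * α₄' + α₄' ^ 2)) ∧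
      SiteBd (fun z => vtilG L V₀ v' v₁ ((L : ℤ) • z)) (α₄ + 6 * d * L * α₄') := by
  refine ⟨fun z μ => ?_, fun z => ?_⟩
  · simp only [B7Prop2Explicit.rescale_apply]
    exact eq199_printed hL hV hα₀ h44 h4a h4b h3c h3d hα₄ hα₄' hα₃ hα₃' hs hα₀s z μ
  · exact eq200_printed hL hV h4a h4b h3c h3d (hα₄.trans (by norm_num)) hα₄' hα₃ (by linarith) hs z

end Assembly





end Literature.MathematicalPhysics.QuantumFieldTheory.Balaban1983to89.B7Ineq199General
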